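import Literature.Computability.Complexity.CodeFPListKit
import Literature.Computability.Complexity.CodeFPLists
import Literature.Computability.Complexity.CodeFPStrings
import Literature.Computability.Complexity.TwoColouringScanFP
import Literature.ModelTheory.FiniteModelTheory.CPTCardPTIMESize
import HarnessLib

/-!
# Simulating BGS programs in polynomial time, V: the simulation runs on codes in polynomial time

Topic `Literature/ModelTheory/FiniteModelTheory`; fifth support file of the discharge of
`Literature.ModelTheory.FiniteModelTheory.CPTCardInPTIME` (Blass–Gurevich–Shelah 1999, §5.2
Theorem 1: "There is a PTime-bounded Turing machine that … simulates the given PTime program").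
The simulation `runP` (`CPTCardPTIMECensus.lean`) with the budget `budget` (`CPTCardPTIMESize.lean`)
is a first-order functional program on lists of naturals; here it is run ON CODES by the typed
polynomial-time algebra `CodeFP` (`CodeFP*.lean`: maps between encoded types computed by `FP`
string functions, closed under composition, pairing, tests, bounded folds):

* the codes: indices `natE`, index lists / tables / environments / coded states as raw lists,
  the table-with-flag `tsE`, contexts `ctxE` (budget and number of atoms in unary, adjacency bits,
  coded state);
* `foldCapFP` — **the guarded fold is polynomial time for ANY polynomial-time step**: the guard
  keeps the code of the accumulator below the (unary) budget, so the accumulator bound demanded by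
  `CodeFP.foldl` holds on every input, with a polynomial read off the output-length polynomial of
  the step (`exists_poly_length_le_of_mem_FP`) — this is where the resource guard pays;
* the primitives (`elems`, lookups, `dedupKeep`, `sameSet`, `findSet`, `mkSet`, `mkOrd`, masks,
  `fireS`, …), the evaluator `ev`/`evArgs` and `den` for a FIXED program by structural induction,
  `round`, `run`, the unary arithmetic of the bound functions and `budget`, and finally
  `runStatusFP`: `(1ⁿ, adj) ↦` the status of `runP P (budget P n) n adj` is `CodeFP`.

## References

* A. Blass, Y. Gurevich, S. Shelah, *Choiceless polynomial time*, Ann. Pure Appl. Logic 100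
  (1999) = arXiv:math/9705225, §5.2 Theorem 1.
* S. Arora, B. Barak, *Computational Complexity: A Modern Approach*, CUP 2009, §1.3 (polynomial
  time is closed under composition and polynomially bounded loops).
-/

noncomputable section

namespace Literature.ModelTheory.FiniteModelTheory.BGS.Sim

open _root_.Computability Polynomial Literature.Computability.Complexity
  Literature.Computability.Complexity.CodeFP

/-! ### Codes -/

/-- Codes of index lists. [folklore] -/
abbrev ilE : List ℕ → List Bool := rawE natE

/-- Codes of tables. [folklore] -/
abbrev tabE : List (List ℕ) → List Bool := rawE ilE

/-- Codes of tables-with-flag. [folklore] -/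
abbrev tsE : TS → List Bool := pairE tabE bitE

/-- Codes of environments. [folklore] -/
abbrev envE : List (ℕ × ℕ) → List Bool := rawE (pairE natE natE)

/-- Codes of locations `(f, argument indices)`. [folklore] -/
abbrev locE : ℕ × List ℕ → List Bool := pairE natE ilE

/-- Codes of coded updates. [folklore] -/
abbrev updE : CUpdate → List Bool := pairE locE natE

/-- Codes of coded states. [folklore] -/
abbrev srepE : List CUpdate → List Bool := rawE updE

/-- The tuple of a context. [folklore] -/
def Ctx.tup (C : Ctx) : ℕ × (ℕ × (List Bool × List CUpdate)) := (C.B, (C.n, (C.adj, C.srep)))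

/-- Codes of context tuples: budget and number of atoms in UNARY, adjacency bits, coded state.
[folklore] -/
abbrev ctupE : ℕ × (ℕ × (List Bool × List CUpdate)) → List Bool :=
  pairE unE (pairE unE (pairE strE srepE))

/-- Codes of contexts. [folklore] -/
def ctxE : Ctx → List Bool := fun C => ctupE C.tup

/-- Index lists have injective codes. [folklore] -/
theorem ilE_injective : Function.Injective ilE := rawE_injective natE_injective

/-- Locations have injective codes. [folklore] -/
theorem locE_injective : Function.Injective locE := pairE_injective natE_injective ilE_injective

variable {α β γ σ δ : Type} {eα : α → List Bool} {eβ : β → List Bool} {eγ : γ → List Bool}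
  {eσ : σ → List Bool} {eδ : δ → List Bool}

/-! ### Unary arithmetic -/

/-- Product of unary numerals. [folklore] -/
theorem unMul : CodeFP (pairE unE unE) unE (fun p => p.1 * p.2) :=
  ((ulength unitE).comp (unitsMul.comp ((replicateUnit.comp (fst _ _)).pair
    (replicateUnit.comp (snd _ _))))).congr fun p => by simp

/-- Comparison of unary numerals. [folklore] -/
theorem unLt : CodeFP (pairE unE unE) bitE (fun p => decide (p.1 < p.2)) :=
  natLt.comp ((natOfUn.comp (fst _ _)).pair (natOfUn.comp (snd _ _)))

/-- `cP` on unary numerals. [folklore] -/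
theorem cPFP : CodeFP (pairE unE unE) unE (fun p => cP p.1 p.2) :=
  (unAdd.comp ((unAdd.comp (((unMulConst 2).comp (fst _ _)).pair (const _ 2))).pair (snd _ _))).congr
    fun p => by simp [cP]

/-! ### The guarded fold is polynomial time -/

/-- The code length of the accumulator does not depend on the flag. [folklore] -/
theorem length_accE_flag (eγ : γ → List Bool) (T : List (List ℕ)) (b b' : Bool) (x : γ) :
    (pairE tsE eγ ((T, b), x)).length = (pairE tsE eγ ((T, b'), x)).length := by
  simp [pairE, bitE]

/-- **The guarded fold runs in polynomial time, for any polynomial-time step.** Whatever the step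
does on junk, before every round the guard compares the code length of the accumulator with the
unary budget; so along the fold the accumulator is either the initial one, or a copy of the
previous one, or the image of an accumulator of length at most the budget — polynomially bounded
in the whole input in each case, which is the accumulator bound `CodeFP.foldl` asks for.
[cite: AroraBarak2009, §1.3 (bounded loops), §1.4.1 (clocked simulation)] -/
theorem foldCapFP {μ : TS × γ → ℕ} (hμ : ∀ x, μ x = (pairE tsE eγ x).length)
    {step : σ → α → TS × γ → TS × γ} {init : σ → TS × γ} {bud : σ → ℕ}
    (hstep : CodeFP (pairE eσ (pairE eα (pairE tsE eγ))) (pairE tsE eγ) (fun t => step t.1 t.2.1 t.2.2))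
    (hinit : CodeFP eσ (pairE tsE eγ) init) (hbud : CodeFP eσ unE bud) :
    CodeFP (pairE eσ (rawE eα)) (pairE tsE eγ) (fun p => foldCap μ (bud p.1) (step p.1) (init p.1) p.2) := by
  -- the guarded step is polynomial time
  let step' : σ → α → TS × γ → TS × γ := fun s a acc =>
    if acc.1.2 || decide (bud s < μ acc) then ((acc.1.1, true), acc.2) else step s a acc
  have hacc : CodeFP (pairE eσ (pairE eα (pairE tsE eγ))) (pairE tsE eγ) (fun t => t.2.2) := ((snd _ _).snd' :)
  have hflag : CodeFP (pairE eσ (pairE eα (pairE tsE eγ))) bitE (fun t => t.2.2.1.2) := (hacc.fst'.snd' :)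
  have hcode : CodeFP (pairE tsE eγ) strE (fun x => pairE tsE eγ x) :=
    (CodeFP.id (pairE tsE eγ)).recodeOut fun _ => rfl
  have hlen : CodeFP (pairE eσ (pairE eα (pairE tsE eγ))) unE (fun t => (pairE tsE eγ t.2.2).length) :=
    (strLength.comp (hcode.comp hacc) :)
  have hlt : CodeFP (pairE eσ (pairE eα (pairE tsE eγ))) bitE
      (fun t => decide (bud t.1 < (pairE tsE eγ t.2.2).length)) :=
    (unLt.comp ((hbud.comp (fst _ _)).pair hlen) :)
  have hflagged : CodeFP (pairE eσ (pairE eα (pairE tsE eγ))) (pairE tsE eγ)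
      (fun t => ((t.2.2.1.1, true), t.2.2.2)) :=
    ((hacc.fst'.fst'.pair (const _ true)).pair hacc.snd' :)
  have hstep' : CodeFP (pairE eσ (pairE eα (pairE tsE eγ))) (pairE tsE eγ) (fun t => step' t.1 t.2.1 t.2.2) :=
    ((hflag.or hlt).ite hflagged hstep).congr fun t => by simp only [step', hμ]
  -- polynomial bounds of the pieces
  obtain ⟨Fs, hFs, hFse⟩ := hstep
  obtain ⟨Ps, hPs⟩ := exists_poly_length_le_of_mem_FP hFs
  obtain ⟨Fi, hFi, hFie⟩ := id hinit
  obtain ⟨Pi, hPi⟩ := exists_poly_length_le_of_mem_FP hFi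
  obtain ⟨Fb, hFb, hFbe⟩ := id hbud
  obtain ⟨Pb, hPb⟩ := exists_poly_length_le_of_mem_FP hFb
  have h := CodeFP.foldl (step := step') (init := init) hstep' hinit (Pi + Ps.comp (4 * X + 4 + Pb))
    (fun s l₁ l₂ => by
      set L := (pairE eσ (rawE eα) (s, l₁ ++ l₂)).length with hL
      have hLeq : L = 2 * (eσ s).length + 2 + (rawE eα (l₁ ++ l₂)).length := by
        simp only [hL, pairE_apply, length_boolPair]
      have hsL : (eσ s).length ≤ L := by omega
      have haL : ∀ a ∈ l₁, (eα a).length ≤ L := fun a ha => by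
        have := length_item_le_length_rawE eα (List.mem_append_left l₂ ha)
        omega
      have hinitL : (pairE tsE eγ (init s)).length ≤ Pi.eval L := by
        rw [← hFie]; exact (hPi _).trans (TM2Iter.eval_mono Pi hsL)
      have hbudL : bud s ≤ Pb.eval L := by
        have := hPb (eσ s)
        rw [hFbe, length_unE] at this
        exact this.trans (TM2Iter.eval_mono Pb hsL)
      -- along the fold the accumulator stays bounded
      have key : ∀ l : List α, (∀ a ∈ l, (eα a).length ≤ L) →
          (pairE tsE eγ (l.foldl (fun b a => step' s a b) (init s))).length ≤
            Pi.eval L + Ps.eval (4 * L + 4 + Pb.eval L) := by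
        intro l
        induction l using List.reverseRecOn with
        | nil => intro _; exact hinitL.trans (Nat.le_add_right _ _)
        | append_singleton l a ih =>
          intro hal
          rw [List.foldl_append, List.foldl_cons, List.foldl_nil]
          set acc := l.foldl (fun b a => step' s a b) (init s)
          have iha := ih fun x hx => hal x (List.mem_append_left _ hx)
          show (pairE tsE eγ (step' s a acc)).length ≤ _
          simp only [step']
          split
          · rw [length_accE_flag eγ acc.1.1 true acc.1.2]
            exact iha
          · rename_i hg
            simp only [Bool.or_eq_true, decide_eq_true_eq, not_or, not_lt, hμ] at hg
            have hlenarg : (pairE eσ (pairE eα (pairE tsE eγ)) (s, a, acc)).length =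
                2 * (eσ s).length + 2 + (2 * (eα a).length + 2 + (pairE tsE eγ acc).length) := by
              simp only [pairE_apply, length_boolPair]
            have harg : (pairE eσ (pairE eα (pairE tsE eγ)) (s, a, acc)).length ≤ 4 * L + 4 + Pb.eval L := by
              have h1 := hal a (by simp)
              have h2 : (pairE tsE eγ acc).length ≤ Pb.eval L := hg.2.trans hbudL
              rw [hlenarg]
              omega
            rw [← hFse (s, a, acc)]
            exact ((hPs _).trans (TM2Iter.eval_mono Ps harg)).trans (Nat.le_add_left _ _)
      refine (key l₁ haL).trans (le_of_eq ?_)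
      simp only [eval_add, eval_comp, eval_mul, eval_ofNat, eval_X])
  exact h.congr fun p => rfl

/-! ### Contexts -/

/-- Building a context from its tuple is the identity on codes. [folklore] -/
theorem ctxOfTup : CodeFP ctupE ctxE (fun p => (⟨p.1, p.2.1, p.2.2.1, p.2.2.2⟩ : Ctx)) :=
  transparent fun _ => rfl

/-- The tuple of a context. [folklore] -/
theorem ctxTup : CodeFP ctxE ctupE Ctx.tup := transparent fun _ => rfl

/-- The budget of a context (unary). [folklore] -/
theorem ctxB : CodeFP ctxE unE Ctx.B := (fst _ _).comp ctxTup

/-- The number of atoms of a context (unary). [folklore] -/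
theorem ctxN : CodeFP ctxE unE Ctx.n := (snd _ _).fst'.comp ctxTup

/-- The number of atoms of a context (binary). [folklore] -/
theorem ctxNnat : CodeFP ctxE natE Ctx.n := (natOfUn.comp ctxN).congr fun _ => rfl

/-- The adjacency bits of a context. [folklore] -/
theorem ctxAdj : CodeFP ctxE strE Ctx.adj := (snd _ _).snd'.fst'.comp ctxTup

/-- The coded state of a context. [folklore] -/
theorem ctxSrep : CodeFP ctxE srepE Ctx.srep := (snd _ _).snd'.snd'.comp ctxTup

/-! ### Primitives on tables -/

/-- `elems` on codes: `(1ⁿ, T, i) ↦ elems n T i`. [folklore] -/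
theorem elemsFP : CodeFP (pairE unE (pairE tabE natE)) ilE (fun p => elems p.1 p.2.1 p.2.2) := by
  have hn : CodeFP (pairE unE (pairE tabE natE)) natE (fun p => p.1) := (natOfUn.comp (fst _ _) :)
  have hi : CodeFP (pairE unE (pairE tabE natE)) natE (fun p => p.2.2) := ((snd _ _).snd' :)
  have hget : CodeFP (pairE unE (pairE tabE natE)) ilE (fun p => p.2.1.getD p.2.2 []) :=
    ((rawGetD ilE (d := []) rfl).comp (snd _ _) :)
  exact ((natLt.comp (hi.pair hn)).ite (const _ []) hget).congr fun p => by
    simp only [elems, decide_eq_true_eq]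

/-- `lookupEnv` on codes: `(dflt, ρ, v) ↦ lookupEnv dflt ρ v`. [folklore] -/
theorem lookupEnvFP : CodeFP (pairE natE (pairE envE natE)) natE (fun p => lookupEnv p.1 p.2.1 p.2.2) := by
  have hpred : CodeFP (pairE natE (pairE natE natE)) bitE (fun q => q.2.1 == q.1) :=
    ((beq natE_injective).comp ((snd _ _).fst'.pair (fst _ _)) :)
  have hfind : CodeFP (pairE natE (pairE envE natE)) (optE (pairE natE natE))
      (fun p => p.2.1.find? fun q => q.1 == p.2.2) :=
    ((rawFind? hpred).comp ((snd _ _).snd'.pair (snd _ _).fst') :)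
  have h := optCases (σ := ℕ × (List (ℕ × ℕ) × ℕ)) (eσ := pairE natE (pairE envE natE))
    (α := ℕ × ℕ) (eα := pairE natE natE) (eδ := natE)
    (k := fun p o => match o with | some q => q.2 | none => p.1)
    (gnone := fun p => p.1) (gsome := fun t => t.2.2) (fst _ _) (snd _ _).snd' (fun _ => rfl) (fun _ _ => rfl)
  exact (h.comp ((CodeFP.id _).pair hfind)).congr fun p => by
    simp only [lookupEnv]
    cases p.2.1.find? (fun q => q.1 == p.2.2) <;> rfl

/-- `lookupS` on codes: `(dflt, srep, (f, idxs)) ↦ lookupS dflt srep f idxs`. [folklore] -/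
theorem lookupSFP : CodeFP (pairE natE (pairE srepE locE)) natE (fun p => lookupS p.1 p.2.1 p.2.2.1 p.2.2.2) := by
  have hpred : CodeFP (pairE locE updE) bitE (fun q => q.2.1 == q.1) :=
    ((beq locE_injective).comp ((snd _ _).fst'.pair (fst _ _)) :)
  have hfind : CodeFP (pairE natE (pairE srepE locE)) (optE updE)
      (fun p => p.2.1.find? fun e => e.1 == p.2.2) :=
    ((rawFind? hpred).comp ((snd _ _).snd'.pair (snd _ _).fst') :)
  have h := optCases (σ := ℕ × (List CUpdate × (ℕ × List ℕ))) (eσ := pairE natE (pairE srepE locE))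
    (α := CUpdate) (eα := updE) (eδ := natE)
    (k := fun p o => match o with | some e => e.2 | none => p.1)
    (gnone := fun p => p.1) (gsome := fun t => t.2.2) (fst _ _) (snd _ _).snd' (fun _ => rfl) (fun _ _ => rfl)
  exact (h.comp ((CodeFP.id _).pair hfind)).congr fun p => by
    obtain ⟨d, srep, f, idxs⟩ := p
    simp only [lookupS]
    cases srep.find? (fun e => e.1 == (f, idxs)) <;> rfl

/-- `dedupKeep` on codes. [folklore] -/
theorem dedupKeepFP : CodeFP ilE ilE dedupKeep := by
  have hmem : CodeFP (pairE natE ilE) bitE (fun t => decide (t.1 ∈ t.2)) := (mem natE_injective :)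
  have hstep : CodeFP (pairE natE ilE) ilE (fun t => dedupStep t.2 t.1) :=
    (hmem.ite (snd _ _) ((rawAppend natE).comp ((snd _ _).pair ((rawSingleton natE).comp (fst _ _))))).congr
      fun t => by simp only [dedupStep, decide_eq_true_eq]
  have h := foldl₀ (eα := natE) (eβ := ilE) (step := fun a acc => dedupStep acc a) (b₀ := []) hstep X
    (fun l₁ l₂ => by
      rw [eval_X]
      obtain ⟨hnd, hmem', -⟩ := foldl_dedupStep l₁ [] List.nodup_nil
      exact length_rawE_le_of_nodup_subset natE hnd fun a ha => by
        have := (hmem' a).mp ha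
        simp only [List.not_mem_nil, false_or] at this
        exact List.mem_append_left l₂ this)
  exact h.congr fun l => rfl

/-- `sameSet` on codes. [folklore] -/
theorem sameSetFP : CodeFP (pairE ilE ilE) bitE (fun p => sameSet p.1 p.2) := by
  have hmem : CodeFP (pairE ilE natE) bitE (fun t => decide (t.2 ∈ t.1)) :=
    ((mem natE_injective).comp ((snd _ _).pair (fst _ _)) :)
  have h1 : CodeFP (pairE ilE ilE) bitE (fun p => p.1.all fun k => decide (k ∈ p.2)) :=
    ((all hmem).comp ((snd _ _).pair (fst _ _)) :)
  have h2 : CodeFP (pairE ilE ilE) bitE (fun p => p.2.all fun k => decide (k ∈ p.1)) := (all hmem :)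
  exact (h1.and h2).congr fun p => rfl

/-- `findSet` on codes: `(1ⁿ, T, l) ↦ findSet n T l`. [folklore] -/
theorem findSetFP : CodeFP (pairE unE (pairE tabE ilE)) (optE natE) (fun p => findSet p.1 p.2.1 p.2.2) := by
  -- the predicate `n ≤ j ∧ sameSet T[j] l` in the context `(n, T, l)`
  have hj : CodeFP (pairE (pairE unE (pairE tabE ilE)) natE) natE (fun q => q.2) := (snd _ _ :)
  have hn : CodeFP (pairE (pairE unE (pairE tabE ilE)) natE) unE (fun q => q.1.1) := ((fst _ _).fst' :)
  have hle : CodeFP (pairE (pairE unE (pairE tabE ilE)) natE) bitE (fun q => decide (q.1.1 ≤ q.2)) :=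
    (unLeNat.comp (hn.pair hj) :)
  have hget : CodeFP (pairE (pairE unE (pairE tabE ilE)) natE) ilE (fun q => q.1.2.1.getD q.2 []) :=
    ((rawGetD ilE (d := []) rfl).comp ((fst _ _).snd'.fst'.pair hj) :)
  have hpred : CodeFP (pairE (pairE unE (pairE tabE ilE)) natE) bitE
      (fun q => decide (q.1.1 ≤ q.2) && sameSet (q.1.2.1.getD q.2 []) q.1.2.2) :=
    (hle.and (sameSetFP.comp (hget.pair (fst _ _).snd'.snd')) :)
  have hrange : CodeFP (pairE unE (pairE tabE ilE)) (rawE natE) (fun p => List.range p.2.1.length) :=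
    (urange.comp ((ulength ilE).comp (snd _ _).fst') :)
  exact ((rawFind? hpred).comp ((CodeFP.id _).pair hrange)).congr fun p => rfl

/-- `mkSet` on codes: `(1ⁿ, T, l) ↦ mkSet n T l`. [folklore] -/
theorem mkSetFP : CodeFP (pairE unE (pairE tabE ilE)) (pairE tabE natE) (fun p => mkSet p.1 p.2.1 p.2.2) := by
  have hd : CodeFP (pairE unE (pairE tabE ilE)) ilE (fun p => dedupKeep p.2.2) := dedupKeepFP.comp (snd _ _).snd'
  have hfind : CodeFP (pairE unE (pairE tabE ilE)) (optE natE) (fun p => findSet p.1 p.2.1 (dedupKeep p.2.2)) :=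
    (findSetFP.comp ((fst _ _).pair ((snd _ _).fst'.pair hd)) :)
  have hnone : CodeFP (pairE unE (pairE tabE ilE)) (pairE tabE natE)
      (fun p => (p.2.1 ++ [dedupKeep p.2.2], p.2.1.length)) :=
    (((rawAppend ilE).comp ((snd _ _).fst'.pair ((rawSingleton ilE).comp hd))).pair
      ((natLength ilE).comp (snd _ _).fst') :)
  have hsome : CodeFP (pairE (pairE unE (pairE tabE ilE)) natE) (pairE tabE natE) (fun t => (t.1.2.1, t.2)) :=
    ((fst _ _).snd'.fst'.pair (snd _ _) :)
  have h := optCases (k := fun p o => match o with | some j => (p.2.1, j) | none => (p.2.1 ++ [dedupKeep p.2.2], p.2.1.length))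
    hnone hsome (fun _ => rfl) (fun _ _ => rfl)
  exact (h.comp ((CodeFP.id _).pair hfind)).congr fun p => by
    simp only [mkSet]
    cases findSet p.1 p.2.1 (dedupKeep p.2.2) <;> rfl

/-- `mk` on codes: `(1ⁿ, S, l) ↦ mk n S l`. [folklore] -/
theorem mkFP : CodeFP (pairE unE (pairE tsE ilE)) (pairE tsE natE) (fun p => mk p.1 p.2.1 p.2.2) := by
  have hm : CodeFP (pairE unE (pairE tsE ilE)) (pairE tabE natE) (fun p => mkSet p.1 p.2.1.1 p.2.2) :=
    (mkSetFP.comp ((fst _ _).pair ((snd _ _).fst'.fst'.pair (snd _ _).snd')) :)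
  exact ((hm.fst'.pair (snd _ _).fst'.snd').pair hm.snd' :)

/-- `boolIdx` on codes. [folklore] -/
theorem boolIdxFP : CodeFP (pairE unE bitE) natE (fun p => boolIdx p.1 p.2) := by
  have hn : CodeFP (pairE unE bitE) natE (fun p => p.1) := (natOfUn.comp (fst _ _) :)
  exact ((snd _ _).ite (natAdd.comp (hn.pair (const _ 1))) hn).congr fun p => by
    cases p.2 <;> rfl

/-- `isTrueIdx` on codes. [folklore] -/
theorem isTrueIdxFP : CodeFP (pairE unE natE) bitE (fun p => isTrueIdx p.1 p.2) := by
  have hn : CodeFP (pairE unE natE) natE (fun p => p.1) := (natOfUn.comp (fst _ _) :)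
  exact ((beq natE_injective).comp ((snd _ _).pair (natAdd.comp (hn.pair (const _ 1))))).congr fun p => rfl

/-- `isBoolIdx` on codes. [folklore] -/
theorem isBoolIdxFP : CodeFP (pairE unE natE) bitE (fun p => isBoolIdx p.1 p.2) := by
  have hn : CodeFP (pairE unE natE) natE (fun p => p.1) := (natOfUn.comp (fst _ _) :)
  have h1 : CodeFP (pairE unE natE) bitE (fun p => p.2 == p.1) := (beq natE_injective).comp ((snd _ _).pair hn)
  exact (h1.or isTrueIdxFP).congr fun p => rfl

/-- `theUniqueIdx` on codes. [folklore] -/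
theorem theUniqueIdxFP : CodeFP (pairE natE ilE) natE (fun p => theUniqueIdx p.1 p.2) := by
  have hcons : CodeFP (pairE natE (pairE natE ilE)) natE
      (fun t => if t.2.2.isEmpty then t.2.1 else t.1) :=
    (((rawIsEmpty natE).comp (snd _ _).snd').ite (snd _ _).fst' (fst _ _) :)
  have h := rawCases (k := fun d l => theUniqueIdx d l) (gnil := fun d => d)
    (gcons := fun t => if t.2.2.isEmpty then t.2.1 else t.1) (CodeFP.id natE) hcons (fun _ => rfl)
    (fun d a l => by cases l <;> rfl)
  exact h

/-- `adjIdx` on codes: `((1ⁿ, adj), (i, j)) ↦ adjIdx n adj i j`. [folklore] -/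
theorem adjIdxFP : CodeFP (pairE (pairE unE strE) (pairE natE natE)) bitE
    (fun p => adjIdx p.1.1 p.1.2 p.2.1 p.2.2) := by
  have hn : CodeFP (pairE (pairE unE strE) (pairE natE natE)) natE (fun p => p.1.1) :=
    (natOfUn.comp (fst _ _).fst' :)
  have hi : CodeFP (pairE (pairE unE strE) (pairE natE natE)) bitE (fun p => decide (p.2.1 < p.1.1)) :=
    (natLt.comp ((snd _ _).fst'.pair hn) :)
  have hj : CodeFP (pairE (pairE unE strE) (pairE natE natE)) bitE (fun p => decide (p.2.2 < p.1.1)) :=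
    (natLt.comp ((snd _ _).snd'.pair hn) :)
  exact ((hi.and hj).and TwoColouring.adjFP).congr fun p => rfl

/-! ### The ordinal loop -/

/-- `ordStep` on codes: `(1ⁿ, acc) ↦ ordStep n acc`. [folklore] -/
theorem ordStepFP : CodeFP (pairE unE (pairE tsE (pairE ilE natE))) (pairE tsE (pairE ilE natE))
    (fun p => ordStep p.1 p.2) := by
  have hl : CodeFP (pairE unE (pairE tsE (pairE ilE natE))) ilE (fun p => p.2.2.1 ++ [p.2.2.2]) :=
    ((rawAppend natE).comp ((snd _ _).snd'.fst'.pair ((rawSingleton natE).comp (snd _ _).snd'.snd')) :)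
  have hm : CodeFP (pairE unE (pairE tsE (pairE ilE natE))) (pairE tsE natE) (fun p => mk p.1 p.2.1 (p.2.2.1 ++ [p.2.2.2])) :=
    (mkFP.comp ((fst _ _).pair ((snd _ _).fst'.pair hl)) :)
  exact (hm.fst'.pair (hl.pair hm.snd') :)

/-- The measure `μO` is the code length. [folklore] -/
theorem μO_eq (acc : TS × (List ℕ × ℕ)) : μO acc = (pairE tsE (pairE ilE natE) acc).length := by
  obtain ⟨⟨T, b⟩, ords, cur⟩ := acc
  simp only [μO, cTS, cP, cT, cL, cN, pairE_apply, length_boolPair, bitE, List.length_singleton, length_rawE,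
    length_natE]

/-- `mkOrd` on codes: `(B, 1ⁿ, S, l) ↦ mkOrd B n S l` (budget and atoms in unary). [folklore] -/
theorem mkOrdFP : CodeFP (pairE unE (pairE unE (pairE tsE ilE))) (pairE tsE natE)
    (fun p => mkOrd p.1 p.2.1 p.2.2.1 p.2.2.2) := by
  -- context `(B, n, S)`, driving list `l`
  have hstep : CodeFP (pairE (pairE unE (pairE unE tsE)) (pairE natE (pairE tsE (pairE ilE natE))))
      (pairE tsE (pairE ilE natE)) (fun t => ordStep t.1.2.1 t.2.2) :=
    (ordStepFP.comp ((fst _ _).snd'.fst'.pair (snd _ _).snd') :)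
  have hr0 : CodeFP (pairE unE (pairE unE tsE)) (pairE tsE natE) (fun s => mk s.2.1 s.2.2 []) :=
    (mkFP.comp ((snd _ _).fst'.pair ((snd _ _).snd'.pair (const _ []))) :)
  have hinit : CodeFP (pairE unE (pairE unE tsE)) (pairE tsE (pairE ilE natE))
      (fun s => ((mk s.2.1 s.2.2 []).1, ([], (mk s.2.1 s.2.2 []).2))) :=
    (hr0.fst'.pair ((const _ []).pair hr0.snd') :)
  have hfold := foldCapFP (σ := ℕ × (ℕ × TS)) (α := ℕ) (γ := List ℕ × ℕ) (eσ := pairE unE (pairE unE tsE))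
    (eα := natE) (eγ := pairE ilE natE) (μ := μO) μO_eq (step := fun s (_ : ℕ) acc => ordStep s.2.1 acc)
    (init := fun s => ((mk s.2.1 s.2.2 []).1, ([], (mk s.2.1 s.2.2 []).2))) (bud := fun s => s.1) hstep hinit
    (fst _ _)
  have h : CodeFP (pairE unE (pairE unE (pairE tsE ilE))) (pairE tsE (pairE ilE natE))
      (fun p => foldCap μO p.1 (fun _ acc => ordStep p.2.1 acc)
        ((mk p.2.1 p.2.2.1 []).1, ([], (mk p.2.1 p.2.2.1 []).2)) p.2.2.2) :=
    (hfold.comp (((fst _ _).pair ((snd _ _).fst'.pair (snd _ _).snd'.fst')).pair (snd _ _).snd'.snd') :)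
  exact (h.fst'.pair h.snd'.snd' :)

/-! ### The evaluator on codes -/

/-- Codes of the input of the evaluator: context, environment, table-with-flag. [folklore] -/
abbrev inE : Ctx × (List (ℕ × ℕ) × TS) → List Bool := pairE ctxE (pairE envE tsE)

/-- Codes of the output of the evaluator: table-with-flag and an index. [folklore] -/
abbrev outE : TS × ℕ → List Bool := pairE tsE natE

section EvFP

/-- The context of the input. [folklore] -/
theorem inCtx : CodeFP inE ctxE (fun x => x.1) := fst _ _

/-- The environment of the input. [folklore] -/
theorem inEnv : CodeFP inE envE (fun x => x.2.1) := (snd _ _).fst'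

/-- The table-with-flag of the input. [folklore] -/
theorem inTS : CodeFP inE tsE (fun x => x.2.2) := (snd _ _).snd'

/-- The number of atoms of the input (unary). [folklore] -/
theorem inN : CodeFP inE unE (fun x => x.1.n) := ctxN.comp inCtx

/-- The number of atoms of the input (binary). [folklore] -/
theorem inNnat : CodeFP inE natE (fun x => x.1.n) := ctxNnat.comp inCtx

/-- The budget of the input (unary). [folklore] -/
theorem inB : CodeFP inE unE (fun x => x.1.B) := ctxB.comp inCtx

/-- The adjacency bits of the input. [folklore] -/
theorem inAdj : CodeFP inE strE (fun x => x.1.adj) := ctxAdj.comp inCtx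

/-- The coded state of the input. [folklore] -/
theorem inSrep : CodeFP inE srepE (fun x => x.1.srep) := ctxSrep.comp inCtx

/-- **`ev` at the term `t` is polynomial time on codes.** [folklore] -/
def EvFP (t : Term) : Prop := CodeFP inE outE (fun x => ev x.1 t x.2.1 x.2.2)

/-- `evArgs` at the argument list `a` is polynomial time on codes. [folklore] -/
def EvAFP (a : Args) : Prop := CodeFP inE (pairE tsE ilE) (fun x => evArgs x.1 a x.2.1 x.2.2)

/-- Re-entering the evaluator with a new table (same context and environment). [folklore] -/
theorem reenter {f : Ctx × (List (ℕ × ℕ) × TS) → TS} (hf : CodeFP inE tsE f) :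
    CodeFP inE inE (fun x => (x.1, (x.2.1, f x))) := (inCtx.pair (inEnv.pair hf) :)

/-- **Sequencing two evaluations** (the shape of the binary clauses): the second runs on the
table left by the first. [folklore] -/
theorem seqFP {s t : Term} (hs : EvFP s) (ht : EvFP t) :
    CodeFP inE (pairE tsE (pairE natE natE))
      (fun x => ((ev x.1 t x.2.1 (ev x.1 s x.2.1 x.2.2).1).1,
        ((ev x.1 s x.2.1 x.2.2).2, (ev x.1 t x.2.1 (ev x.1 s x.2.1 x.2.2).1).2))) := by
  have h2 : CodeFP inE outE (fun x => ev x.1 t x.2.1 (ev x.1 s x.2.1 x.2.2).1) := (ht.comp (reenter hs.fst') :)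
  exact (h2.fst'.pair (hs.snd'.pair h2.snd') :)

/-- A clause returning a truth-value index computed from `(n, adj)`, the final table and the two
indices. [folklore] -/
theorem seqBoolFP {s t : Term} (hs : EvFP s) (ht : EvFP t) {f : (ℕ × List Bool) × (List (List ℕ) × (ℕ × ℕ)) → Bool}
    (hf : CodeFP (pairE (pairE unE strE) (pairE tabE (pairE natE natE))) bitE f)
    (F : Term) (hF : ∀ C ρ S, ev C F ρ S =
      ((ev C t ρ (ev C s ρ S).1).1, boolIdx C.n (f ((C.n, C.adj), ((ev C t ρ (ev C s ρ S).1).1.1,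
        ((ev C s ρ S).2, (ev C t ρ (ev C s ρ S).1).2)))))) : EvFP F := by
  have hq := seqFP hs ht
  have hb : CodeFP inE bitE (fun x => f ((x.1.n, x.1.adj), ((ev x.1 t x.2.1 (ev x.1 s x.2.1 x.2.2).1).1.1,
      ((ev x.1 s x.2.1 x.2.2).2, (ev x.1 t x.2.1 (ev x.1 s x.2.1 x.2.2).1).2)))) :=
    (hf.comp ((inN.pair inAdj).pair (hq.fst'.fst'.pair hq.snd')) :)
  have h : CodeFP inE outE (fun x => ((ev x.1 t x.2.1 (ev x.1 s x.2.1 x.2.2).1).1,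
      boolIdx x.1.n (f ((x.1.n, x.1.adj), ((ev x.1 t x.2.1 (ev x.1 s x.2.1 x.2.2).1).1.1,
        ((ev x.1 s x.2.1 x.2.2).2, (ev x.1 t x.2.1 (ev x.1 s x.2.1 x.2.2).1).2)))))) :=
    (hq.fst'.pair (boolIdxFP.comp (inN.pair hb)) :)
  exact h.congr fun x => (hF x.1 x.2.1 x.2.2).symm

/-- `ev` at a variable. [folklore] -/
theorem evFP_var (v : ℕ) : EvFP (.var v) := by
  have h : CodeFP inE outE (fun x => (x.2.2, lookupEnv x.1.n x.2.1 v)) :=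
    (inTS.pair (lookupEnvFP.comp (inNnat.pair (inEnv.pair (const _ v)))) :)
  exact h.congr fun x => by simp only [ev]

/-- `ev` at `∅`. [folklore] -/
theorem evFP_empty : EvFP .empty := by
  have h : CodeFP inE outE (fun x => (x.2.2, x.1.n)) := (inTS.pair inNnat :)
  exact h.congr fun x => by simp only [ev]

/-- `ev` at `false`. [folklore] -/
theorem evFP_cFalse : EvFP .cFalse := by
  have h : CodeFP inE outE (fun x => (x.2.2, x.1.n)) := (inTS.pair inNnat :)
  exact h.congr fun x => by simp only [ev]

/-- `ev` at `true`. [folklore] -/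
theorem evFP_cTrue : EvFP .cTrue := by
  have h : CodeFP inE outE (fun x => (x.2.2, x.1.n + 1)) := (inTS.pair (natAdd.comp (inNnat.pair (const _ 1))) :)
  exact h.congr fun x => by simp only [ev]

/-- `ev` at `Atoms`. [folklore] -/
theorem evFP_atoms : EvFP .atoms := by
  have h : CodeFP inE outE (fun x => mk x.1.n x.2.2 (List.range x.1.n)) :=
    (mkFP.comp (inN.pair (inTS.pair (urange.comp inN))) :)
  exact h.congr fun x => by simp only [ev]

/-- The member list of the value just computed: `(x, r) ↦ elems n r.1.1 r.2`. [folklore] -/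
theorem elemsOut : CodeFP (pairE inE outE) ilE (fun q => elems q.1.1.n q.2.1.1 q.2.2) :=
  (elemsFP.comp ((inN.comp (fst _ _)).pair ((snd _ _).fst'.fst'.pair (snd _ _).snd')) :)

/-- `ev` at `⋃ t`. [folklore] -/
theorem evFP_sUnion {t : Term} (ht : EvFP t) : EvFP (.sUnion t) := by
  -- the flattened member lists of the members
  have hctx : CodeFP (pairE inE outE) (pairE unE tabE) (fun q => (q.1.1.n, q.2.1.1)) :=
    ((inN.comp (fst _ _)).pair (snd _ _).fst'.fst' :)
  have hel : CodeFP (pairE (pairE unE tabE) natE) ilE (fun t => elems t.1.1 t.1.2 t.2) :=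
    (elemsFP.comp ((fst _ _).fst'.pair ((fst _ _).snd'.pair (snd _ _))) :)
  have hmap : CodeFP (pairE inE outE) (rawE ilE)
      (fun q => (elems q.1.1.n q.2.1.1 q.2.2).map fun k => elems q.1.1.n q.2.1.1 k) :=
    ((map hel).comp (hctx.pair elemsOut) :)
  have hpost : CodeFP (pairE inE outE) outE
      (fun q => mk q.1.1.n q.2.1 (((elems q.1.1.n q.2.1.1 q.2.2).map fun k => elems q.1.1.n q.2.1.1 k).flatten)) :=
    (mkFP.comp ((inN.comp (fst _ _)).pair ((snd _ _).fst'.pair ((flatten natE).comp hmap))) :)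
  exact (hpost.comp ((CodeFP.id _).pair ht)).congr fun x => by simp only [ev]; rfl

/-- `ev` at `TheUnique t`. [folklore] -/
theorem evFP_theUnique {t : Term} (ht : EvFP t) : EvFP (.theUnique t) := by
  have hpost : CodeFP (pairE inE outE) outE (fun q => (q.2.1, theUniqueIdx q.1.1.n (elems q.1.1.n q.2.1.1 q.2.2))) :=
    ((snd _ _).fst'.pair (theUniqueIdxFP.comp ((inNnat.comp (fst _ _)).pair elemsOut)) :)
  exact (hpost.comp ((CodeFP.id _).pair ht)).congr fun x => by simp only [ev, id_eq]

/-- `ev` at `¬ t`. [folklore] -/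
theorem evFP_not {t : Term} (ht : EvFP t) : EvFP (.not t) := by
  have hb : CodeFP (pairE inE outE) bitE (fun q => q.2.2 == q.1.1.n) :=
    ((beq natE_injective).comp ((snd _ _).snd'.pair (inNnat.comp (fst _ _))) :)
  have hpost : CodeFP (pairE inE outE) outE (fun q => (q.2.1, boolIdx q.1.1.n (q.2.2 == q.1.1.n))) :=
    ((snd _ _).fst'.pair (boolIdxFP.comp ((inN.comp (fst _ _)).pair hb)) :)
  exact (hpost.comp ((CodeFP.id _).pair ht)).congr fun x => by simp only [ev, id_eq]

/-- `ev` at `Card t`. [folklore] -/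
theorem evFP_card {t : Term} (ht : EvFP t) : EvFP (.card t) := by
  have hpost : CodeFP (pairE inE outE) outE
      (fun q => mkOrd q.1.1.B q.1.1.n q.2.1 (elems q.1.1.n q.2.1.1 q.2.2)) :=
    (mkOrdFP.comp ((inB.comp (fst _ _)).pair ((inN.comp (fst _ _)).pair ((snd _ _).fst'.pair elemsOut))) :)
  exact (hpost.comp ((CodeFP.id _).pair ht)).congr fun x => by simp only [ev, id_eq]

/-- `ev` at `Pair(s, t)`. [folklore] -/
theorem evFP_pair {s t : Term} (hs : EvFP s) (ht : EvFP t) : EvFP (.pair s t) := by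
  have hq := seqFP hs ht
  have hl : CodeFP inE ilE (fun x => [(ev x.1 s x.2.1 x.2.2).2, (ev x.1 t x.2.1 (ev x.1 s x.2.1 x.2.2).1).2]) :=
    ((rawCons natE).comp (hq.snd'.fst'.pair ((rawSingleton natE).comp hq.snd'.snd')) :)
  have h : CodeFP inE outE (fun x => mk x.1.n (ev x.1 t x.2.1 (ev x.1 s x.2.1 x.2.2).1).1
      [(ev x.1 s x.2.1 x.2.2).2, (ev x.1 t x.2.1 (ev x.1 s x.2.1 x.2.2).1).2]) :=
    (mkFP.comp (inN.pair (hq.fst'.pair hl)) :)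
  exact h.congr fun x => by simp only [ev]

/-- `ev` at `s ∈ t`. [folklore] -/
theorem evFP_mem {s t : Term} (hs : EvFP s) (ht : EvFP t) : EvFP (.mem s t) := by
  have hel : CodeFP (pairE (pairE unE strE) (pairE tabE (pairE natE natE))) ilE (fun q => elems q.1.1 q.2.1 q.2.2.2) :=
    (elemsFP.comp ((fst _ _).fst'.pair ((snd _ _).fst'.pair (snd _ _).snd'.snd')) :)
  have hf : CodeFP (pairE (pairE unE strE) (pairE tabE (pairE natE natE))) bitE
      (fun q => decide (q.2.2.1 ∈ elems q.1.1 q.2.1 q.2.2.2)) :=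
    ((mem natE_injective).comp ((snd _ _).snd'.fst'.pair hel) :)
  exact seqBoolFP hs ht hf (.mem s t) fun C ρ S => by simp only [ev]

/-- `ev` at `s = t`. [folklore] -/
theorem evFP_eq {s t : Term} (hs : EvFP s) (ht : EvFP t) : EvFP (.eq s t) := by
  have hf : CodeFP (pairE (pairE unE strE) (pairE tabE (pairE natE natE))) bitE (fun q => q.2.2.1 == q.2.2.2) :=
    ((beq natE_injective).comp (snd _ _).snd' :)
  exact seqBoolFP hs ht hf (.eq s t) fun C ρ S => by simp only [ev]

/-- `isTrueIdx` of the two indices. [folklore] -/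
theorem isTrue12 : CodeFP (pairE (pairE unE strE) (pairE tabE (pairE natE natE))) (pairE bitE bitE)
    (fun q => (isTrueIdx q.1.1 q.2.2.1, isTrueIdx q.1.1 q.2.2.2)) :=
  ((isTrueIdxFP.comp ((fst _ _).fst'.pair (snd _ _).snd'.fst')).pair
    (isTrueIdxFP.comp ((fst _ _).fst'.pair (snd _ _).snd'.snd')) :)

/-- `isBoolIdx` of the two indices. [folklore] -/
theorem isBool12 : CodeFP (pairE (pairE unE strE) (pairE tabE (pairE natE natE))) (pairE bitE bitE)
    (fun q => (isBoolIdx q.1.1 q.2.2.1, isBoolIdx q.1.1 q.2.2.2)) :=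
  ((isBoolIdxFP.comp ((fst _ _).fst'.pair (snd _ _).snd'.fst')).pair
    (isBoolIdxFP.comp ((fst _ _).fst'.pair (snd _ _).snd'.snd')) :)

/-- `ev` at `s ∧ t`. [folklore] -/
theorem evFP_and {s t : Term} (hs : EvFP s) (ht : EvFP t) : EvFP (.and s t) :=
  seqBoolFP hs ht (isTrue12.fst'.and isTrue12.snd') (.and s t) fun C ρ S => by simp only [ev]

/-- `ev` at `s ∨ t`. [folklore] -/
theorem evFP_or {s t : Term} (hs : EvFP s) (ht : EvFP t) : EvFP (.or s t) :=
  seqBoolFP hs ht ((isBool12.fst'.and isBool12.snd').and (isTrue12.fst'.or isTrue12.snd')) (.or s t)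
    fun C ρ S => by simp only [ev]

/-- `ev` at `E(s, t)`. [folklore] -/
theorem evFP_edge {s t : Term} (hs : EvFP s) (ht : EvFP t) : EvFP (.edge s t) :=
  seqBoolFP hs ht (adjIdxFP.comp ((fst _ _).pair (snd _ _).snd')) (.edge s t) fun C ρ S => by simp only [ev]

/-- `ev` at a dynamic function symbol. [folklore] -/
theorem evFP_dyn {f : ℕ} {args : Args} (ha : EvAFP args) : EvFP (.dyn f args) := by
  have hpost : CodeFP (pairE inE (pairE tsE ilE)) outE
      (fun q => (q.2.1, lookupS q.1.1.n q.1.1.srep f q.2.2)) :=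
    ((snd _ _).fst'.pair (lookupSFP.comp ((inNnat.comp (fst _ _)).pair ((inSrep.comp (fst _ _)).pair
      ((const _ f).pair (snd _ _).snd')))) :)
  exact (hpost.comp ((CodeFP.id _).pair ha)).congr fun x => by simp only [ev, id_eq]

/-- The measure `μC` is the code length. [folklore] -/
theorem μC_eq (acc : TS × List ℕ) : μC acc = (pairE tsE ilE acc).length := by
  obtain ⟨⟨T, b⟩, out⟩ := acc
  simp only [μC, cTS, cP, cT, cL, cN, pairE_apply, length_boolPair, bitE, List.length_singleton, length_rawE,
    length_natE]

/-- Entering the loop body: context and the extended environment `(v, a) :: ρ` with the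
accumulator's table, from `((x, a), acc)`-shaped data `(x, (a, S))`. [folklore] -/
theorem bodyIn (v : ℕ) : CodeFP (pairE inE (pairE natE tsE)) inE
    (fun q => (q.1.1, (((v, q.2.1) :: q.1.2.1), q.2.2))) :=
  ((fst _ _).fst'.pair (((rawCons (pairE natE natE)).comp (((const _ v).pair (snd _ _).fst').pair
    (fst _ _).snd'.fst')).pair (snd _ _).snd') :)

/-- The comprehension round on codes. [folklore] -/
theorem comprStepFP {v : ℕ} {t g : Term} (ht : EvFP t) (hg : EvFP g) :
    CodeFP (pairE inE (pairE natE (pairE tsE ilE))) (pairE tsE ilE)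
      (fun q => comprStep q.1.1 v t g q.1.2.1 q.2.1 q.2.2) := by
  -- the guard `g` at `(v, a) :: ρ` on the accumulator's table
  have hgi : CodeFP (pairE inE (pairE natE (pairE tsE ilE))) inE
      (fun q => (q.1.1, (((v, q.2.1) :: q.1.2.1), q.2.2.1))) :=
    ((bodyIn v).comp ((fst _ _).pair ((snd _ _).fst'.pair (snd _ _).snd'.fst')) :)
  have hrg : CodeFP (pairE inE (pairE natE (pairE tsE ilE))) outE
      (fun q => ev q.1.1 g ((v, q.2.1) :: q.1.2.1) q.2.2.1) := (hg.comp hgi :)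
  -- the head `t` on the table left by the guard
  have hti : CodeFP (pairE inE (pairE natE (pairE tsE ilE))) inE
      (fun q => (q.1.1, (((v, q.2.1) :: q.1.2.1), (ev q.1.1 g ((v, q.2.1) :: q.1.2.1) q.2.2.1).1))) :=
    ((bodyIn v).comp ((fst _ _).pair ((snd _ _).fst'.pair hrg.fst')) :)
  have hrt : CodeFP (pairE inE (pairE natE (pairE tsE ilE))) outE
      (fun q => ev q.1.1 t ((v, q.2.1) :: q.1.2.1) (ev q.1.1 g ((v, q.2.1) :: q.1.2.1) q.2.2.1).1) := (ht.comp hti :)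
  have hyes : CodeFP (pairE inE (pairE natE (pairE tsE ilE))) (pairE tsE ilE)
      (fun q => ((ev q.1.1 t ((v, q.2.1) :: q.1.2.1) (ev q.1.1 g ((v, q.2.1) :: q.1.2.1) q.2.2.1).1).1,
        q.2.2.2 ++ [(ev q.1.1 t ((v, q.2.1) :: q.1.2.1) (ev q.1.1 g ((v, q.2.1) :: q.1.2.1) q.2.2.1).1).2])) :=
    (hrt.fst'.pair ((rawAppend natE).comp ((snd _ _).snd'.snd'.pair ((rawSingleton natE).comp hrt.snd'))) :)
  have hno : CodeFP (pairE inE (pairE natE (pairE tsE ilE))) (pairE tsE ilE)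
      (fun q => ((ev q.1.1 g ((v, q.2.1) :: q.1.2.1) q.2.2.1).1, q.2.2.2)) := (hrg.fst'.pair (snd _ _).snd'.snd' :)
  have hb : CodeFP (pairE inE (pairE natE (pairE tsE ilE))) bitE
      (fun q => isTrueIdx q.1.1.n (ev q.1.1 g ((v, q.2.1) :: q.1.2.1) q.2.2.1).2) :=
    (isTrueIdxFP.comp ((inN.comp (fst _ _)).pair hrg.snd') :)
  exact (hb.ite hyes hno).congr fun q => by
    unfold comprStep
    rfl

/-- `ev` at a comprehension term. [Blass–Gurevich–Shelah 1999, §4.4] [folklore] -/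
theorem evFP_compr {v : ℕ} {t r g : Term} (ht : EvFP t) (hr : EvFP r) (hg : EvFP g) : EvFP (.compr v t r g) := by
  have hstep := comprStepFP (v := v) ht hg
  have hinit : CodeFP inE (pairE tsE ilE) (fun x => ((ev x.1 r x.2.1 x.2.2).1, [])) := (hr.fst'.pair (const _ []) :)
  have hfold := foldCapFP (σ := Ctx × (List (ℕ × ℕ) × TS)) (α := ℕ) (γ := List ℕ) (eσ := inE) (eα := natE)
    (eγ := ilE) (μ := μC) μC_eq (step := fun x a acc => comprStep x.1 v t g x.2.1 a acc)
    (init := fun x => ((ev x.1 r x.2.1 x.2.2).1, [])) (bud := fun x => x.1.B) hstep hinit inB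
  have hlist : CodeFP inE ilE (fun x => elems x.1.n (ev x.1 r x.2.1 x.2.2).1.1 (ev x.1 r x.2.1 x.2.2).2) :=
    (elemsOut.comp ((CodeFP.id _).pair hr) :)
  have hres : CodeFP inE (pairE tsE ilE) (fun x => foldCap μC x.1.B (fun a acc => comprStep x.1 v t g x.2.1 a acc)
      ((ev x.1 r x.2.1 x.2.2).1, []) (elems x.1.n (ev x.1 r x.2.1 x.2.2).1.1 (ev x.1 r x.2.1 x.2.2).2)) :=
    (hfold.comp ((CodeFP.id _).pair hlist) :)
  have h : CodeFP inE outE (fun x =>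
      mk x.1.n (foldCap μC x.1.B (fun a acc => comprStep x.1 v t g x.2.1 a acc)
        ((ev x.1 r x.2.1 x.2.2).1, []) (elems x.1.n (ev x.1 r x.2.1 x.2.2).1.1 (ev x.1 r x.2.1 x.2.2).2)).1
      (foldCap μC x.1.B (fun a acc => comprStep x.1 v t g x.2.1 a acc)
        ((ev x.1 r x.2.1 x.2.2).1, []) (elems x.1.n (ev x.1 r x.2.1 x.2.2).1.1 (ev x.1 r x.2.1 x.2.2).2)).2) :=
    (mkFP.comp (inN.pair (hres.fst'.pair hres.snd')) :)
  exact h.congr fun x => (ev_compr x.1 v t r g x.2.1 x.2.2).symm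

/-- `evArgs` at the empty list. [folklore] -/
theorem evAFP_nil : EvAFP .nil := by
  have h : CodeFP inE (pairE tsE ilE) (fun x => (x.2.2, [])) := (inTS.pair (const _ []) :)
  exact h.congr fun x => by simp only [evArgs]

/-- `evArgs` at a nonempty list. [folklore] -/
theorem evAFP_cons {t : Term} {rest : Args} (ht : EvFP t) (hr : EvAFP rest) : EvAFP (.cons t rest) := by
  have h2 : CodeFP inE (pairE tsE ilE) (fun x => evArgs x.1 rest x.2.1 (ev x.1 t x.2.1 x.2.2).1) :=
    (hr.comp (reenter ht.fst') :)
  have h : CodeFP inE (pairE tsE ilE) (fun x => ((evArgs x.1 rest x.2.1 (ev x.1 t x.2.1 x.2.2).1).1,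
      (ev x.1 t x.2.1 x.2.2).2 :: (evArgs x.1 rest x.2.1 (ev x.1 t x.2.1 x.2.2).1).2)) :=
    (h2.fst'.pair ((rawCons natE).comp (ht.snd'.pair h2.snd')) :)
  exact h.congr fun x => by simp only [evArgs]

mutual
/-- **The evaluator is polynomial time on codes** (every term). [Blass–Gurevich–Shelah 1999,
§5.2 Theorem 1] [folklore] -/
theorem evFP : ∀ t : Term, EvFP t
  | .var v => evFP_var v
  | .empty => evFP_empty
  | .atoms => evFP_atoms
  | .sUnion t => evFP_sUnion (evFP t)
  | .theUnique t => evFP_theUnique (evFP t)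
  | .pair s t => evFP_pair (evFP s) (evFP t)
  | .card t => evFP_card (evFP t)
  | .mem s t => evFP_mem (evFP s) (evFP t)
  | .eq s t => evFP_eq (evFP s) (evFP t)
  | .cTrue => evFP_cTrue
  | .cFalse => evFP_cFalse
  | .not t => evFP_not (evFP t)
  | .and s t => evFP_and (evFP s) (evFP t)
  | .or s t => evFP_or (evFP s) (evFP t)
  | .edge s t => evFP_edge (evFP s) (evFP t)
  | .dyn _ args => evFP_dyn (evAFP args)
  | .compr _ t r g => evFP_compr (evFP t) (evFP r) (evFP g)
/-- The evaluator on argument lists is polynomial time on codes. [folklore] -/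
theorem evAFP : ∀ a : Args, EvAFP a
  | .nil => evAFP_nil
  | .cons t rest => evAFP_cons (evFP t) (evAFP rest)
end

end EvFP

/-! ### Rules and firing on codes -/

section DenFP

/-- **`den` at the rule `R` is polynomial time on codes.** [folklore] -/
def DenFP (R : Rule) : Prop := CodeFP inE (pairE tsE srepE) (fun x => den x.1 R x.2.1 x.2.2)

/-- `den` at `Skip`. [folklore] -/
theorem denFP_skip : DenFP .skip := by
  have h : CodeFP inE (pairE tsE srepE) (fun x => (x.2.2, [])) := (inTS.pair (const _ []) :)
  exact h.congr fun x => by simp only [den]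

/-- `den` at an update rule. [folklore] -/
theorem denFP_update (f : ℕ) (args : Args) (t : Term) : DenFP (.update f args t) := by
  have ha := evAFP args
  have h2 : CodeFP inE outE (fun x => ev x.1 t x.2.1 (evArgs x.1 args x.2.1 x.2.2).1) := ((evFP t).comp (reenter ha.fst') :)
  have hu : CodeFP inE updE (fun x => ((f, (evArgs x.1 args x.2.1 x.2.2).2), (ev x.1 t x.2.1 (evArgs x.1 args x.2.1 x.2.2).1).2)) :=
    (((const _ f).pair ha.snd').pair h2.snd' :)
  have h : CodeFP inE (pairE tsE srepE) (fun x => ((ev x.1 t x.2.1 (evArgs x.1 args x.2.1 x.2.2).1).1,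
      [((f, (evArgs x.1 args x.2.1 x.2.2).2), (ev x.1 t x.2.1 (evArgs x.1 args x.2.1 x.2.2).1).2)])) :=
    (h2.fst'.pair ((rawSingleton updE).comp hu) :)
  exact h.congr fun x => by simp only [den]

/-- `den` at a conditional rule. [folklore] -/
theorem denFP_cond {g : Term} {R₁ R₂ : Rule} (h₁ : DenFP R₁) (h₂ : DenFP R₂) : DenFP (.cond g R₁ R₂) := by
  have hg := evFP g
  have hb : CodeFP inE bitE (fun x => isTrueIdx x.1.n (ev x.1 g x.2.1 x.2.2).2) := (isTrueIdxFP.comp (inN.pair hg.snd') :)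
  have hd₁ : CodeFP inE (pairE tsE srepE) (fun x => den x.1 R₁ x.2.1 (ev x.1 g x.2.1 x.2.2).1) := (h₁.comp (reenter hg.fst') :)
  have hd₂ : CodeFP inE (pairE tsE srepE) (fun x => den x.1 R₂ x.2.1 (ev x.1 g x.2.1 x.2.2).1) := (h₂.comp (reenter hg.fst') :)
  exact (hb.ite hd₁ hd₂).congr fun x => by simp only [den]

/-- The measure `μU` is the code length. [folklore] -/
theorem μU_eq (acc : TS × List CUpdate) : μU acc = (pairE tsE srepE acc).length := by
  obtain ⟨⟨T, b⟩, ups⟩ := acc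
  simp only [μU, cTS, cUL, cU, cP, cT, cL, cN, pairE_apply, length_boolPair, bitE, List.length_singleton,
    length_rawE, length_natE]

/-- The `do forall` round on codes. [folklore] -/
theorem forallStepFP {v : ℕ} {R : Rule} (hR : DenFP R) :
    CodeFP (pairE inE (pairE natE (pairE tsE srepE))) (pairE tsE srepE)
      (fun q => forallStep q.1.1 v R q.1.2.1 q.2.1 q.2.2) := by
  have hi : CodeFP (pairE inE (pairE natE (pairE tsE srepE))) inE
      (fun q => (q.1.1, (((v, q.2.1) :: q.1.2.1), q.2.2.1))) :=
    ((bodyIn v).comp ((fst _ _).pair ((snd _ _).fst'.pair (snd _ _).snd'.fst')) :)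
  have hd : CodeFP (pairE inE (pairE natE (pairE tsE srepE))) (pairE tsE srepE)
      (fun q => den q.1.1 R ((v, q.2.1) :: q.1.2.1) q.2.2.1) := (hR.comp hi :)
  have h : CodeFP (pairE inE (pairE natE (pairE tsE srepE))) (pairE tsE srepE)
      (fun q => ((den q.1.1 R ((v, q.2.1) :: q.1.2.1) q.2.2.1).1, q.2.2.2 ++ (den q.1.1 R ((v, q.2.1) :: q.1.2.1) q.2.2.1).2)) :=
    (hd.fst'.pair ((rawAppend updE).comp ((snd _ _).snd'.snd'.pair hd.snd')) :)
  exact h.congr fun q => rfl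

/-- `den` at a `do forall` rule. [Blass–Gurevich–Shelah 1999, §4.5–4.6] [folklore] -/
theorem denFP_forallDo {v : ℕ} {r : Term} {R : Rule} (hR : DenFP R) : DenFP (.forallDo v r R) := by
  have hr := evFP r
  have hstep := forallStepFP (v := v) hR
  have hinit : CodeFP inE (pairE tsE srepE) (fun x => ((ev x.1 r x.2.1 x.2.2).1, [])) := (hr.fst'.pair (const _ []) :)
  have hfold := foldCapFP (σ := Ctx × (List (ℕ × ℕ) × TS)) (α := ℕ) (γ := List CUpdate) (eσ := inE) (eα := natE)
    (eγ := srepE) (μ := μU) μU_eq (step := fun x a acc => forallStep x.1 v R x.2.1 a acc)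
    (init := fun x => ((ev x.1 r x.2.1 x.2.2).1, [])) (bud := fun x => x.1.B) hstep hinit inB
  have hlist : CodeFP inE ilE (fun x => elems x.1.n (ev x.1 r x.2.1 x.2.2).1.1 (ev x.1 r x.2.1 x.2.2).2) :=
    (elemsOut.comp ((CodeFP.id _).pair hr) :)
  have hres : CodeFP inE (pairE tsE srepE) (fun x => foldCap μU x.1.B (fun a acc => forallStep x.1 v R x.2.1 a acc)
      ((ev x.1 r x.2.1 x.2.2).1, []) (elems x.1.n (ev x.1 r x.2.1 x.2.2).1.1 (ev x.1 r x.2.1 x.2.2).2)) :=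
    (hfold.comp ((CodeFP.id _).pair hlist) :)
  exact hres.congr fun x => (den_forallDo x.1 v r R x.2.1 x.2.2).symm

/-- **`den` is polynomial time on codes** (every rule). [Blass–Gurevich–Shelah 1999, §5.2
Theorem 1] [folklore] -/
theorem denFP : ∀ R : Rule, DenFP R
  | .skip => denFP_skip
  | .update f args t => denFP_update f args t
  | .cond _ R₁ R₂ => denFP_cond (denFP R₁) (denFP R₂)
  | .forallDo _ _ R => denFP_forallDo (denFP R)

end DenFP

/-- `consistentB` on codes. [folklore] -/
theorem consistentBFP : CodeFP srepE bitE consistentB := by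
  have hloc : CodeFP (pairE updE updE) bitE (fun q => q.1.1 == q.2.1) :=
    ((beq locE_injective).comp ((fst _ _).fst'.pair (snd _ _).fst') :)
  have hval : CodeFP (pairE updE updE) bitE (fun q => q.1.2 == q.2.2) :=
    ((beq natE_injective).comp ((fst _ _).snd'.pair (snd _ _).snd') :)
  have hinner : CodeFP (pairE updE srepE) bitE (fun q => q.2.all fun u' => !(q.1.1 == u'.1) || (q.1.2 == u'.2)) :=
    (all (hloc.not.or hval) :)
  have hctx : CodeFP (pairE srepE updE) bitE (fun q => q.1.all fun u' => !(q.2.1 == u'.1) || (q.2.2 == u'.2)) :=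
    (hinner.comp ((snd _ _).pair (fst _ _)) :)
  have h : CodeFP (pairE srepE srepE) bitE (fun q => q.2.all fun u => q.1.all fun u' => !(u.1 == u'.1) || (u.2 == u'.2)) :=
    (all hctx :)
  exact (h.comp ((CodeFP.id _).pair (CodeFP.id _))).congr fun ups => rfl

/-- `fireS` on codes: `(1ⁿ, srep, ups) ↦ fireS n srep ups`. [Blass–Gurevich–Shelah 1999, §4.6]
[folklore] -/
theorem fireSFP : CodeFP (pairE unE (pairE srepE srepE)) srepE (fun p => fireS p.1 p.2.1 p.2.2) := by
  have hn : CodeFP (pairE unE (pairE srepE srepE)) natE (fun p => p.1) := (natOfUn.comp (fst _ _) :)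
  have hups : CodeFP (pairE unE (pairE srepE srepE)) srepE (fun p => p.2.2) := ((snd _ _).snd' :)
  have hsrep : CodeFP (pairE unE (pairE srepE srepE)) srepE (fun p => p.2.1) := ((snd _ _).fst' :)
  -- updates with non-`∅` content
  have hp1 : CodeFP (pairE natE updE) bitE (fun q => !(q.2.2 == q.1)) :=
    (((beq natE_injective).comp ((snd _ _).snd'.pair (fst _ _))).not :)
  have hf1 : CodeFP (pairE unE (pairE srepE srepE)) srepE (fun p => p.2.2.filter fun u => !(u.2 == p.1)) :=
    ((filter hp1).comp (hn.pair hups) :)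
  -- old entries not overwritten
  have hany : CodeFP (pairE updE updE) bitE (fun q => q.2.1 == q.1.1) :=
    ((beq locE_injective).comp ((snd _ _).fst'.pair (fst _ _).fst') :)
  have hp2 : CodeFP (pairE srepE updE) bitE (fun q => !(q.1.any fun u => u.1 == q.2.1)) :=
    (((any hany).comp ((snd _ _).pair (fst _ _))).not :)
  have hf2 : CodeFP (pairE unE (pairE srepE srepE)) srepE
      (fun p => p.2.1.filter fun e => !(p.2.2.any fun u => u.1 == e.1)) :=
    ((filter hp2).comp (hups.pair hsrep) :)
  have hcons : CodeFP (pairE unE (pairE srepE srepE)) bitE (fun p => consistentB p.2.2) := (consistentBFP.comp hups :)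
  exact ((hcons.ite ((rawAppend updE).comp (hf1.pair hf2)) hsrep).congr fun p => by simp only [fireS])

/-! ### The census on codes (masks code themselves as bit strings) -/

/-- `critMask` on codes: `(1ⁿ, T, srep) ↦ critMask n T srep`. [Blass–Gurevich–Shelah 1999, §5.1]
[folklore] -/
theorem critMaskFP : CodeFP (pairE unE (pairE tabE srepE)) strE (fun p => critMask p.1 p.2.1 p.2.2) := by
  -- the predicate on `((n, srep), i)`
  have hocc : CodeFP (pairE natE natE) bitE (fun q => q.2 == q.1) := ((beq natE_injective).comp ((snd _ _).pair (fst _ _)) :)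
  have he : CodeFP (pairE natE updE) bitE (fun q => q.2.2 == q.1 || q.2.1.2.any (· == q.1)) :=
    (((beq natE_injective).comp ((snd _ _).snd'.pair (fst _ _))).or ((any hocc).comp ((fst _ _).pair (snd _ _).fst'.snd')) :)
  have hany : CodeFP (pairE (pairE unE srepE) natE) bitE
      (fun q => q.1.2.any fun e => e.2 == q.2 || e.1.2.any (· == q.2)) :=
    ((any he).comp ((snd _ _).pair (fst _ _).snd') :)
  have hn2 : CodeFP (pairE (pairE unE srepE) natE) natE (fun q => q.1.1 + 2) :=
    (natAdd.comp ((natOfUn.comp (fst _ _).fst').pair (const _ 2)) :)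
  have hlt : CodeFP (pairE (pairE unE srepE) natE) bitE (fun q => decide (q.2 < q.1.1 + 2)) := (natLt.comp ((snd _ _).pair hn2) :)
  have hmap : CodeFP (pairE (pairE unE srepE) (rawE natE)) (rawE bitE)
      (fun q => q.2.map fun i => decide (i < q.1.1 + 2) || q.1.2.any fun e => e.2 == i || e.1.2.any (· == i)) :=
    (map (hlt.or hany) :)
  have hrange : CodeFP (pairE unE (pairE tabE srepE)) (rawE natE) (fun p => List.range p.2.1.length) :=
    (urange.comp ((ulength ilE).comp (snd _ _).fst') :)
  have h : CodeFP (pairE unE (pairE tabE srepE)) strE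
      (fun p => (List.range p.2.1.length).map fun i =>
        decide (i < p.1 + 2) || p.2.2.any fun e => e.2 == i || e.1.2.any (· == i)) :=
    (bitsToStr.comp (hmap.comp ((((fst _ _).pair (snd _ _).snd')).pair hrange)) :)
  exact h.congr fun p => rfl

/-- `markAll` on codes. [folklore] -/
theorem markAllFP : CodeFP (pairE strE ilE) strE (fun p => markAll p.1 p.2) := by
  have hbit : CodeFP (pairE (pairE strE ilE) natE) bitE (fun q => q.1.1.getD q.2 false || decide (q.2 ∈ q.1.2)) :=
    ((strGetDNat.comp ((fst _ _).fst'.pair (snd _ _))).or ((mem natE_injective).comp ((snd _ _).pair (fst _ _).snd')) :)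
  have h : CodeFP (pairE strE ilE) strE
      (fun p => (List.range p.1.length).map fun i => p.1.getD i false || decide (i ∈ p.2)) :=
    (bitsToStr.comp ((map hbit).comp ((CodeFP.id _).pair (urange.comp (strLength.comp (fst _ _))))) :)
  exact h.congr fun p => rfl

/-- `closeStep` on codes: `((1ⁿ, T), (m, i)) ↦ closeStep n T m i`. [folklore] -/
theorem closeStepFP : CodeFP (pairE (pairE unE tabE) (pairE strE natE)) strE
    (fun p => closeStep p.1.1 p.1.2 p.2.1 p.2.2) := by
  have hb : CodeFP (pairE (pairE unE tabE) (pairE strE natE)) bitE (fun p => p.2.1.getD p.2.2 false) :=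
    (strGetDNat.comp (snd _ _) :)
  have hel : CodeFP (pairE (pairE unE tabE) (pairE strE natE)) ilE (fun p => elems p.1.1 p.1.2 p.2.2) :=
    (elemsFP.comp ((fst _ _).fst'.pair ((fst _ _).snd'.pair (snd _ _).snd')) :)
  have hm : CodeFP (pairE (pairE unE tabE) (pairE strE natE)) strE (fun p => markAll p.2.1 (elems p.1.1 p.1.2 p.2.2)) :=
    (markAllFP.comp ((snd _ _).fst'.pair hel) :)
  exact (hb.ite hm (snd _ _).fst').congr fun p => by simp only [closeStep]

/-- `closeMask` on codes: `((1ⁿ, T), m) ↦ closeMask n T m`. [folklore] -/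
theorem closeMaskFP : CodeFP (pairE (pairE unE tabE) strE) strE (fun p => closeMask p.1.1 p.1.2 p.2) := by
  -- fold `closeStep` over the reversed index range, context `((n, T), m)`
  have hstep : CodeFP (pairE (pairE (pairE unE tabE) strE) (pairE natE strE)) strE
      (fun t => closeStep t.1.1.1 t.1.1.2 t.2.2 t.2.1) :=
    (closeStepFP.comp ((fst _ _).fst'.pair ((snd _ _).snd'.pair (snd _ _).fst')) :)
  have h := CodeFP.foldl (σ := (ℕ × List (List ℕ)) × List Bool) (α := ℕ) (β := List Bool)
    (eσ := pairE (pairE unE tabE) strE) (eα := natE) (eβ := strE)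
    (step := fun s i m => closeStep s.1.1 s.1.2 m i) (init := fun s => s.2) hstep (snd _ _) X
    (fun s l₁ l₂ => by
      have hlen : ∀ l : List ℕ, (l.foldl (fun m i => closeStep s.1.1 s.1.2 m i) s.2).length = s.2.length := by
        intro l
        induction l using List.reverseRecOn with
        | nil => rfl
        | append_singleton l a ih => rw [List.foldl_append, List.foldl_cons, List.foldl_nil, length_closeStep, ih]
      rw [eval_X]
      change (List.foldl _ s.2 l₁).length ≤ _
      rw [hlen l₁]
      simp only [pairE_apply, length_boolPair]
      have : (strE s.2).length = s.2.length := rfl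
      omega)
  have hlist : CodeFP (pairE (pairE unE tabE) strE) (rawE natE) (fun p => (List.range p.1.2.length).reverse) :=
    ((rawReverse natE).comp (urange.comp ((ulength ilE).comp (fst _ _).snd')) :)
  exact ((h.comp ((CodeFP.id _).pair hlist)).congr fun p => by simp only [closeMask, id_eq])

/-- `activeMask` on codes: `(1ⁿ, T, srep) ↦ activeMask n T srep`. [Blass–Gurevich–Shelah 1999,
§5.1] [folklore] -/
theorem activeMaskFP : CodeFP (pairE unE (pairE tabE srepE)) strE (fun p => activeMask p.1 p.2.1 p.2.2) := by
  have h : CodeFP (pairE unE (pairE tabE srepE)) strE (fun p => closeMask p.1 p.2.1 (critMask p.1 p.2.1 p.2.2)) :=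
    (closeMaskFP.comp (((fst _ _).pair (snd _ _).fst').pair critMaskFP) :)
  exact h.congr fun p => rfl

/-- `orMask` on codes: `(1ᴺ, a, b) ↦ orMask N a b`. [folklore] -/
theorem orMaskFP : CodeFP (pairE unE (pairE strE strE)) strE (fun p => orMask p.1 p.2.1 p.2.2) := by
  have hbit : CodeFP (pairE (pairE unE (pairE strE strE)) natE) bitE
      (fun q => q.1.2.1.getD q.2 false || q.1.2.2.getD q.2 false) :=
    ((strGetDNat.comp ((fst _ _).snd'.fst'.pair (snd _ _))).or (strGetDNat.comp ((fst _ _).snd'.snd'.pair (snd _ _))) :)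
  have h : CodeFP (pairE unE (pairE strE strE)) strE
      (fun p => (List.range p.1).map fun i => p.2.1.getD i false || p.2.2.getD i false) :=
    (bitsToStr.comp ((map hbit).comp ((CodeFP.id _).pair (urange.comp (fst _ _)))) :)
  exact h.congr fun p => rfl

/-- `countTrue` on codes. [folklore] -/
theorem countTrueFP : CodeFP strE natE countTrue := by
  have hp : CodeFP (pairE strE natE) bitE (fun q => q.1.getD q.2 false) := strGetDNat
  have h : CodeFP strE natE (fun m => ((List.range m.length).filter fun i => m.getD i false).length) :=
    ((natLength natE).comp ((filter hp).comp ((CodeFP.id _).pair (urange.comp strLength))) :)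
  exact h.congr fun m => rfl

/-- `statusOf` on codes. [folklore] -/
theorem statusOfFP : CodeFP (pairE unE natE) natE (fun p => statusOf p.1 p.2) := by
  have h2 : CodeFP (pairE unE natE) bitE (fun p => p.2 == p.1) :=
    ((beq natE_injective).comp ((snd _ _).pair (natOfUn.comp (fst _ _))) :)
  exact ((isTrueIdxFP.ite (const _ 1) (h2.ite (const _ 2) (const _ 4))).congr fun p => by simp only [statusOf])

/-! ### Rounds and the run on codes -/

/-- Codes of round states. [folklore] -/
abbrev rsE : RS → List Bool := pairE tsE (pairE srepE (pairE strE natE))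

/-- Codes of the round parameters `(B, n, adj, qn)`: budget and atoms in unary, adjacency bits,
the bound `q(n)` in binary. [folklore] -/
abbrev rparE : ℕ × (ℕ × (List Bool × ℕ)) → List Bool := pairE unE (pairE unE (pairE strE natE))

/-- The measure `μR` is the code length. [folklore] -/
theorem μR_eq (st : RS) : μR st = (rsE st).length := by
  obtain ⟨⟨T, b⟩, srep, act, status⟩ := st
  simp only [μR, cTS, cUL, cU, cBL, cP, cT, cL, cN, pairE_apply, length_boolPair, bitE, List.length_singleton,
    length_rawE, length_natE]
  rfl

/-- **One round on codes.** [Blass–Gurevich–Shelah 1999, §5.1–5.2] [folklore] -/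
theorem roundFP (R : Rule) : CodeFP (pairE rparE rsE) rsE (fun p => round R p.1.1 p.1.2.1 p.1.2.2.1 p.1.2.2.2 p.2) := by
  -- names for the components
  have hB : CodeFP (pairE rparE rsE) unE (fun p => p.1.1) := ((fst _ _).fst' :)
  have hn : CodeFP (pairE rparE rsE) unE (fun p => p.1.2.1) := ((fst _ _).snd'.fst' :)
  have hnn : CodeFP (pairE rparE rsE) natE (fun p => p.1.2.1) := (natOfUn.comp hn :)
  have hadj : CodeFP (pairE rparE rsE) strE (fun p => p.1.2.2.1) := ((fst _ _).snd'.snd'.fst' :)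
  have hqn : CodeFP (pairE rparE rsE) natE (fun p => p.1.2.2.2) := ((fst _ _).snd'.snd'.snd' :)
  have hS : CodeFP (pairE rparE rsE) tsE (fun p => p.2.1) := ((snd _ _).fst' :)
  have hsrep : CodeFP (pairE rparE rsE) srepE (fun p => p.2.2.1) := ((snd _ _).snd'.fst' :)
  have hact : CodeFP (pairE rparE rsE) strE (fun p => p.2.2.2.1) := ((snd _ _).snd'.snd'.fst' :)
  have hstat : CodeFP (pairE rparE rsE) natE (fun p => p.2.2.2.2) := ((snd _ _).snd'.snd'.snd' :)
  -- the accumulated census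
  have hact' : CodeFP (pairE rparE rsE) strE
      (fun p => orMask p.2.1.1.length p.2.2.2.1 (activeMask p.1.2.1 p.2.1.1 p.2.2.1)) :=
    (orMaskFP.comp (((ulength ilE).comp hS.fst').pair (hact.pair (activeMaskFP.comp (hn.pair (hS.fst'.pair hsrep))))) :)
  have hbig : CodeFP (pairE rparE rsE) bitE
      (fun p => decide (p.1.2.2.2 < countTrue (orMask p.2.1.1.length p.2.2.2.1 (activeMask p.1.2.1 p.2.1.1 p.2.2.1)))) :=
    (natLt.comp (hqn.pair (countTrueFP.comp hact')) :)
  have hlook : ∀ f : ℕ, CodeFP (pairE rparE rsE) natE (fun p => lookupS p.1.2.1 p.2.2.1 f []) := fun f =>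
    (lookupSFP.comp (hnn.pair (hsrep.pair ((const _ f).pair (const _ [])))) :)
  have hhalt : CodeFP (pairE rparE rsE) bitE (fun p => isTrueIdx p.1.2.1 (lookupS p.1.2.1 p.2.2.1 haltSym [])) :=
    (isTrueIdxFP.comp (hn.pair (hlook haltSym)) :)
  have hout : CodeFP (pairE rparE rsE) natE (fun p => statusOf p.1.2.1 (lookupS p.1.2.1 p.2.2.1 outputSym [])) :=
    (statusOfFP.comp (hn.pair (hlook outputSym)) :)
  -- the step
  have hctx : CodeFP (pairE rparE rsE) ctxE (fun p => (⟨p.1.1, p.1.2.1, p.1.2.2.1, p.2.2.1⟩ : Ctx)) :=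
    (ctxOfTup.comp (hB.pair (hn.pair (hadj.pair hsrep))) :)
  have hden : CodeFP (pairE rparE rsE) (pairE tsE srepE) (fun p => den ⟨p.1.1, p.1.2.1, p.1.2.2.1, p.2.2.1⟩ R [] p.2.1) :=
    ((denFP R).comp (hctx.pair ((const _ []).pair hS)) :)
  have hfire : CodeFP (pairE rparE rsE) srepE
      (fun p => fireS p.1.2.1 p.2.2.1 (den ⟨p.1.1, p.1.2.1, p.1.2.2.1, p.2.2.1⟩ R [] p.2.1).2) :=
    (fireSFP.comp (hn.pair (hsrep.pair hden.snd')) :)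
  -- the branches
  have habort : CodeFP (pairE rparE rsE) rsE (fun p =>
      (p.2.1, (p.2.2.1, (orMask p.2.1.1.length p.2.2.2.1 (activeMask p.1.2.1 p.2.1.1 p.2.2.1), (3 : ℕ))))) :=
    (hS.pair (hsrep.pair (hact'.pair (const _ 3))) :)
  have hhalted : CodeFP (pairE rparE rsE) rsE (fun p =>
      (p.2.1, (p.2.2.1, (orMask p.2.1.1.length p.2.2.2.1 (activeMask p.1.2.1 p.2.1.1 p.2.2.1),
        statusOf p.1.2.1 (lookupS p.1.2.1 p.2.2.1 outputSym []))))) :=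
    (hS.pair (hsrep.pair (hact'.pair hout)) :)
  have hrun : CodeFP (pairE rparE rsE) rsE (fun p =>
      ((den ⟨p.1.1, p.1.2.1, p.1.2.2.1, p.2.2.1⟩ R [] p.2.1).1,
        (fireS p.1.2.1 p.2.2.1 (den ⟨p.1.1, p.1.2.1, p.1.2.2.1, p.2.2.1⟩ R [] p.2.1).2,
          (orMask p.2.1.1.length p.2.2.2.1 (activeMask p.1.2.1 p.2.1.1 p.2.2.1), (0 : ℕ))))) :=
    (hden.fst'.pair (hfire.pair (hact'.pair (const _ 0))) :)
  have hidle : CodeFP (pairE rparE rsE) bitE (fun p => !(p.2.2.2.2 == (0 : ℕ))) :=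
    (((beq natE_injective).comp (hstat.pair (const _ 0))).not :)
  exact ((hidle.ite (snd _ _) (hbig.ite habort (hhalt.ite hhalted hrun))).congr fun p => by
    unfold round
    rfl)

/-- `initTab` on codes. [folklore] -/
theorem initTabFP : CodeFP unE tabE initTab := by
  have h1 : CodeFP unE tabE (fun n => List.replicate n []) := ((replicateOf ilE).comp ((const _ []).pair (CodeFP.id unE)) :)
  have h2 : CodeFP unE tabE (fun n => [[], [n]]) :=
    ((rawCons ilE).comp ((const _ []).pair ((rawSingleton ilE).comp ((rawSingleton natE).comp natOfUn))) :)
  exact (((rawAppend ilE).comp (h1.pair h2)).congr fun _ => rfl)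

/-- `initRS` on codes. [folklore] -/
theorem initRSFP : CodeFP unE rsE initRS :=
  (((initTabFP.pair (const _ false)).pair ((const _ []).pair ((const _ []).pair (const _ 0)))).congr fun _ => rfl)

/-- Codes of the run parameters `(B, n, adj, qn, pn)` (`pn` in unary). [folklore] -/
abbrev runparE : ℕ × (ℕ × (List Bool × (ℕ × ℕ))) → List Bool := pairE unE (pairE unE (pairE strE (pairE natE unE)))

/-- **The run on codes**: `(B, 1ⁿ, adj, qn, 1^{pn}) ↦ run R B n adj qn pn`. [Blass–Gurevich–Shelah
1999, §5.2 Theorem 1] [folklore] -/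
theorem runFP (R : Rule) : CodeFP runparE rsE (fun p => run R p.1 p.2.1 p.2.2.1 p.2.2.2.1 p.2.2.2.2) := by
  have hpar : CodeFP runparE rparE (fun p => (p.1, (p.2.1, (p.2.2.1, p.2.2.2.1)))) :=
    ((fst _ _).pair ((snd _ _).fst'.pair ((snd _ _).snd'.fst'.pair (snd _ _).snd'.snd'.fst')) :)
  have hstep : CodeFP (pairE runparE (pairE unitE rsE)) rsE
      (fun t => round R t.1.1 t.1.2.1 t.1.2.2.1 t.1.2.2.2.1 t.2.2) :=
    ((roundFP R).comp ((hpar.comp (fst _ _)).pair (snd _ _).snd') :)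
  have hinit : CodeFP runparE rsE (fun p => initRS p.2.1) := (initRSFP.comp (snd _ _).fst' :)
  have hfold := foldCapFP (σ := ℕ × (ℕ × (List Bool × (ℕ × ℕ)))) (α := Unit) (γ := List CUpdate × (List Bool × ℕ))
    (eσ := runparE) (eα := unitE) (eγ := pairE srepE (pairE strE natE)) (μ := μR) μR_eq
    (step := fun s _ st => round R s.1 s.2.1 s.2.2.1 s.2.2.2.1 st) (init := fun s => initRS s.2.1)
    (bud := fun s => s.1) hstep hinit (fst _ _)
  have hlist : CodeFP runparE (rawE unitE) (fun p => List.replicate (p.2.2.2.2 + 1) ()) :=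
    (replicateUnit.comp (unSucc.comp (snd _ _).snd'.snd'.snd') :)
  exact ((hfold.comp ((CodeFP.id _).pair hlist)).congr fun p => by simp only [run, id_eq])

/-! ### The bound functions in unary -/

/-- Evaluating a fixed polynomial with natural coefficients, in unary. [folklore] -/
theorem unPolyFP (q : Polynomial ℕ) : CodeFP unE unE (fun n => q.eval n) := by
  induction q using Polynomial.induction_on' with
  | add p q hp hq => exact (unAdd.comp (hp.pair hq)).congr fun n => by rw [eval_add]
  | monomial k a =>
    exact ((unMulConst a).comp ((ulength unitE).comp (unitsPow k))).congr fun n => by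
      simp [eval_monomial]

/-- Evaluating a fixed polynomial, unary argument, binary value. [folklore] -/
theorem natPolyFP (q : Polynomial ℕ) : CodeFP unE natE (fun n => q.eval n) := (natOfUn.comp (unPolyFP q)).congr fun _ => rfl

/-- The width bound `wB t` in unary. [folklore] -/
theorem wBFP : ∀ t : Term, CodeFP unE unE (wB t)
  | .var _ => (CodeFP.id unE).congr fun _ => rfl
  | .empty => (CodeFP.id unE).congr fun _ => rfl
  | .atoms => (CodeFP.id unE).congr fun _ => rfl
  | .sUnion t => (unAdd.comp ((unMul.comp ((wBFP t).pair (wBFP t))).pair (wBFP t))).congr fun _ => rfl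
  | .theUnique t => (wBFP t).congr fun _ => rfl
  | .pair s t => (unAdd.comp ((unAdd.comp ((wBFP s).pair (wBFP t))).pair (const _ 2))).congr fun _ => rfl
  | .card t => (wBFP t).congr fun _ => rfl
  | .mem _ _ => unSucc.congr fun _ => rfl
  | .eq _ _ => unSucc.congr fun _ => rfl
  | .cTrue => unSucc.congr fun _ => rfl
  | .cFalse => unSucc.congr fun _ => rfl
  | .not _ => unSucc.congr fun _ => rfl
  | .and _ _ => unSucc.congr fun _ => rfl
  | .or _ _ => unSucc.congr fun _ => rfl
  | .edge _ _ => unSucc.congr fun _ => rfl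
  | .dyn _ _ => (CodeFP.id unE).congr fun _ => rfl
  | .compr _ t r _ => (unAdd.comp ((wBFP r).pair ((wBFP t).comp (wBFP r)))).congr fun _ => rfl

mutual
/-- The count `cntT t` in unary. [folklore] -/
theorem cntTFP : ∀ t : Term, CodeFP unE unE (cntT t)
  | .var _ => (const _ 0).congr fun _ => rfl
  | .empty => (const _ 0).congr fun _ => rfl
  | .atoms => (const _ 1).congr fun _ => rfl
  | .sUnion t => (unSucc.comp (cntTFP t)).congr fun _ => rfl
  | .theUnique t => (cntTFP t).congr fun _ => rfl
  | .pair s t => (unSucc.comp (unAdd.comp ((cntTFP s).pair (cntTFP t)))).congr fun _ => rfl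
  | .card t => (unAdd.comp ((unAdd.comp ((cntTFP t).pair (wBFP t))).pair (const _ 2))).congr fun _ => rfl
  | .mem s t => (unAdd.comp ((cntTFP s).pair (cntTFP t))).congr fun _ => rfl
  | .eq s t => (unAdd.comp ((cntTFP s).pair (cntTFP t))).congr fun _ => rfl
  | .cTrue => (const _ 0).congr fun _ => rfl
  | .cFalse => (const _ 0).congr fun _ => rfl
  | .not t => (cntTFP t).congr fun _ => rfl
  | .and s t => (unAdd.comp ((cntTFP s).pair (cntTFP t))).congr fun _ => rfl
  | .or s t => (unAdd.comp ((cntTFP s).pair (cntTFP t))).congr fun _ => rfl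
  | .edge s t => (unAdd.comp ((cntTFP s).pair (cntTFP t))).congr fun _ => rfl
  | .dyn _ args => (cntAFP args).congr fun _ => rfl
  | .compr _ t r g =>
    (unSucc.comp (unAdd.comp ((cntTFP r).pair (unMul.comp ((wBFP r).pair
      (unAdd.comp (((cntTFP g).comp (wBFP r)).pair ((cntTFP t).comp (wBFP r))))))))).congr fun _ => rfl
/-- The count `cntA a` in unary. [folklore] -/
theorem cntAFP : ∀ a : Args, CodeFP unE unE (cntA a)
  | .nil => (const _ 0).congr fun _ => rfl
  | .cons t rest => (unAdd.comp ((cntTFP t).pair (cntAFP rest))).congr fun _ => rfl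
end

/-- `szB` in unary. [folklore] -/
theorem szBFP : CodeFP unE unE szB := (unAdd.comp (((unMulConst 2).comp (CodeFP.id unE)).pair (const _ 2))).congr fun _ => rfl

/-- `tabB` in unary. [folklore] -/
theorem tabBFP : CodeFP unE unE tabB :=
  (unMul.comp ((CodeFP.id unE).pair (unAdd.comp (((unMulConst 2).comp (unMul.comp ((CodeFP.id unE).pair szBFP))).pair
    (const _ 2))))).congr fun _ => rfl

/-- `tsB` in unary. [folklore] -/
theorem tsBFP : CodeFP unE unE tsB := (cPFP.comp (tabBFP.pair (const _ 1))).congr fun _ => rfl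

/-- `μCB` in unary. [folklore] -/
theorem μCBFP : CodeFP (pairE unE unE) unE (fun p => μCB p.1 p.2) :=
  (cPFP.comp ((tsBFP.comp (fst _ _)).pair (unMul.comp ((snd _ _).pair (szBFP.comp (fst _ _)))))).congr fun _ => rfl

/-- `μOB` in unary. [folklore] -/
theorem μOBFP : CodeFP (pairE unE unE) unE (fun p => μOB p.1 p.2) :=
  (cPFP.comp ((tsBFP.comp (fst _ _)).pair (cPFP.comp ((unMul.comp ((snd _ _).pair (szBFP.comp (fst _ _)))).pair
    (fst _ _))))).congr fun _ => rfl

/-- `μUB` in unary: `((m, U), ub) ↦ μUB m U ub`. [folklore] -/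
theorem μUBFP : CodeFP (pairE (pairE unE unE) unE) unE (fun p => μUB p.1.1 p.1.2 p.2) :=
  (cPFP.comp ((tsBFP.comp (fst _ _).fst').pair (unMul.comp ((fst _ _).snd'.pair (unAdd.comp
    (((unMulConst 2).comp (snd _ _)).pair (const _ 2))))))).congr fun _ => rfl

/-- `uB F A` in unary (symbol and arity bounds fixed). [folklore] -/
theorem uBFP (F A : ℕ) : CodeFP unE unE (uB F A) :=
  (cPFP.comp ((cPFP.comp ((const _ F).pair ((unMulConst A).comp szBFP))).pair (CodeFP.id unE))).congr fun _ => rfl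

/-- `μRB` in unary: `((M, S), ub) ↦ μRB M S ub`. [folklore] -/
theorem μRBFP : CodeFP (pairE (pairE unE unE) unE) unE (fun p => μRB p.1.1 p.1.2 p.2) := by
  have hM : CodeFP (pairE (pairE unE unE) unE) unE (fun p => p.1.1) := ((fst _ _).fst' :)
  have hS : CodeFP (pairE (pairE unE unE) unE) unE (fun p => p.1.2) := ((fst _ _).snd' :)
  have hub2 : CodeFP (pairE (pairE unE unE) unE) unE (fun p => 2 * p.2 + 2) :=
    (unAdd.comp (((unMulConst 2).comp (snd _ _)).pair (const _ 2)) :)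
  exact ((cPFP.comp ((tsBFP.comp hM).pair (cPFP.comp ((unMul.comp (hS.pair hub2)).pair
    (cPFP.comp (((unMulConst 4).comp hM).pair (const _ 4))))))).congr fun p => by
      simp only [μRB]; ring_nf)

mutual
/-- The guard bound `gdT t` in unary: `(Y, m) ↦ gdT t Y m`. [folklore] -/
theorem gdTFP : ∀ t : Term, CodeFP (pairE unE unE) unE (fun p => gdT t p.1 p.2)
  | .var _ => (const _ 0).congr fun _ => rfl
  | .empty => (const _ 0).congr fun _ => rfl
  | .atoms => (const _ 0).congr fun _ => rfl
  | .sUnion t => (gdTFP t).congr fun _ => rfl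
  | .theUnique t => (gdTFP t).congr fun _ => rfl
  | .pair s t => (unAdd.comp ((gdTFP s).pair ((gdTFP t).comp ((fst _ _).pair (unAdd.comp ((snd _ _).pair
      ((cntTFP s).comp (fst _ _)))))))).congr fun _ => rfl
  | .card t => (unAdd.comp ((gdTFP t).pair (μOBFP.comp ((unAdd.comp ((unAdd.comp ((unAdd.comp ((snd _ _).pair
      ((cntTFP t).comp (fst _ _)))).pair ((wBFP t).comp (fst _ _)))).pair (const _ 2))).pair
        ((wBFP t).comp (fst _ _)))))).congr fun _ => rfl
  | .mem s t => (unAdd.comp ((gdTFP s).pair ((gdTFP t).comp ((fst _ _).pair (unAdd.comp ((snd _ _).pair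
      ((cntTFP s).comp (fst _ _)))))))).congr fun _ => rfl
  | .eq s t => (unAdd.comp ((gdTFP s).pair ((gdTFP t).comp ((fst _ _).pair (unAdd.comp ((snd _ _).pair
      ((cntTFP s).comp (fst _ _)))))))).congr fun _ => rfl
  | .cTrue => (const _ 0).congr fun _ => rfl
  | .cFalse => (const _ 0).congr fun _ => rfl
  | .not t => (gdTFP t).congr fun _ => rfl
  | .and s t => (unAdd.comp ((gdTFP s).pair ((gdTFP t).comp ((fst _ _).pair (unAdd.comp ((snd _ _).pair
      ((cntTFP s).comp (fst _ _)))))))).congr fun _ => rfl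
  | .or s t => (unAdd.comp ((gdTFP s).pair ((gdTFP t).comp ((fst _ _).pair (unAdd.comp ((snd _ _).pair
      ((cntTFP s).comp (fst _ _)))))))).congr fun _ => rfl
  | .edge s t => (unAdd.comp ((gdTFP s).pair ((gdTFP t).comp ((fst _ _).pair (unAdd.comp ((snd _ _).pair
      ((cntTFP s).comp (fst _ _)))))))).congr fun _ => rfl
  | .dyn _ args => (gdAFP args).congr fun _ => rfl
  | .compr _ t r g => by
    -- `Y' = wB r Y`, `m' = m + cntT r Y + Y' * (cntT g Y' + cntT t Y')`
    have hY' : CodeFP (pairE unE unE) unE (fun p => wB r p.1) := ((wBFP r).comp (fst _ _) :)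
    have hm' : CodeFP (pairE unE unE) unE
        (fun p => p.2 + cntT r p.1 + wB r p.1 * (cntT g (wB r p.1) + cntT t (wB r p.1))) :=
      (unAdd.comp ((unAdd.comp ((snd _ _).pair ((cntTFP r).comp (fst _ _)))).pair (unMul.comp (hY'.pair
        (unAdd.comp (((cntTFP g).comp hY').pair ((cntTFP t).comp hY')))))) :)
    exact (unAdd.comp ((unAdd.comp ((unAdd.comp ((gdTFP r).pair (μCBFP.comp (hm'.pair hY')))).pair
      ((gdTFP g).comp (hY'.pair hm')))).pair ((gdTFP t).comp (hY'.pair hm')))).congr fun _ => rfl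
/-- The guard bound `gdA a` in unary. [folklore] -/
theorem gdAFP : ∀ a : Args, CodeFP (pairE unE unE) unE (fun p => gdA a p.1 p.2)
  | .nil => (const _ 0).congr fun _ => rfl
  | .cons t rest => (unAdd.comp ((gdTFP t).pair ((gdAFP rest).comp ((fst _ _).pair (unAdd.comp ((snd _ _).pair
      ((cntTFP t).comp (fst _ _)))))))).congr fun _ => rfl
end

/-- The update count `ucnt R` in unary. [folklore] -/
theorem ucntFP : ∀ R : Rule, CodeFP unE unE (ucnt R)
  | .skip => (const _ 0).congr fun _ => rfl
  | .update _ _ _ => (const _ 1).congr fun _ => rfl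
  | .cond _ R₁ R₂ => (unAdd.comp ((ucntFP R₁).pair (ucntFP R₂))).congr fun _ => rfl
  | .forallDo _ r R => (unMul.comp ((wBFP r).pair ((ucntFP R).comp (wBFP r)))).congr fun _ => rfl

/-- The count `cntR R` in unary. [folklore] -/
theorem cntRFP : ∀ R : Rule, CodeFP unE unE (cntR R)
  | .skip => (const _ 0).congr fun _ => rfl
  | .update _ args t => (unAdd.comp ((cntAFP args).pair (cntTFP t))).congr fun _ => rfl
  | .cond g R₁ R₂ => (unAdd.comp ((unAdd.comp ((cntTFP g).pair (cntRFP R₁))).pair (cntRFP R₂))).congr fun _ => rfl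
  | .forallDo _ r R => (unAdd.comp ((cntTFP r).pair (unMul.comp ((wBFP r).pair ((cntRFP R).comp (wBFP r)))))).congr
      fun _ => rfl

/-- The guard bound `gdR R` in unary: `(Y, m) ↦ gdR R Y m`. [folklore] -/
theorem gdRFP : ∀ R : Rule, CodeFP (pairE unE unE) unE (fun p => gdR R p.1 p.2)
  | .skip => (const _ 0).congr fun _ => rfl
  | .update _ args t => (unAdd.comp ((gdAFP args).pair ((gdTFP t).comp ((fst _ _).pair (unAdd.comp ((snd _ _).pair
      ((cntAFP args).comp (fst _ _)))))))).congr fun _ => rfl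
  | .cond g R₁ R₂ => by
    have hm : CodeFP (pairE unE unE) (pairE unE unE) (fun p => (p.1, p.2 + cntT g p.1)) :=
      ((fst _ _).pair (unAdd.comp ((snd _ _).pair ((cntTFP g).comp (fst _ _)))) :)
    exact (unAdd.comp ((unAdd.comp ((gdTFP g).pair ((gdRFP R₁).comp hm))).pair ((gdRFP R₂).comp hm))).congr fun _ => rfl
  | .forallDo _ r R => by
    have hY' : CodeFP (pairE unE unE) unE (fun p => wB r p.1) := ((wBFP r).comp (fst _ _) :)
    have hm' : CodeFP (pairE unE unE) unE (fun p => p.2 + cntT r p.1 + wB r p.1 * cntR R (wB r p.1)) :=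
      (unAdd.comp ((unAdd.comp ((snd _ _).pair ((cntTFP r).comp (fst _ _)))).pair (unMul.comp (hY'.pair
        ((cntRFP R).comp hY')))) :)
    have hμ : CodeFP (pairE unE unE) unE (fun p => μUB (p.2 + cntT r p.1 + wB r p.1 * cntR R (wB r p.1))
        (wB r p.1 * ucnt R (wB r p.1)) (uB (symB R) (arB R) (p.2 + cntT r p.1 + wB r p.1 * cntR R (wB r p.1)))) :=
      (μUBFP.comp ((hm'.pair (unMul.comp (hY'.pair ((ucntFP R).comp hY')))).pair ((uBFP (symB R) (arB R)).comp hm')) :)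
    exact (unAdd.comp ((unAdd.comp (((gdTFP r)).pair hμ)).pair ((gdRFP R).comp (hY'.pair hm')))).congr fun _ => rfl

/-- **The budget in unary**: `1ⁿ ↦ 1^{budget P n}`. [Blass–Gurevich–Shelah 1999, §5.2 Theorem 1]
[folklore] -/
theorem budgetFP (P : CPTCardProgram) : CodeFP unE unE (budget P) := by
  have hY : CodeFP unE unE (fun n => P.activeBound.eval n + n) := (unAdd.comp ((unPolyFP _).pair (CodeFP.id unE)) :)
  have hp : CodeFP unE unE (fun n => P.stepBound.eval n) := unPolyFP _
  have hM : CodeFP unE unE (fun n => n + 2 + P.stepBound.eval n * cntR P.prog.rule (P.activeBound.eval n + n)) :=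
    (unAdd.comp ((unAdd.comp ((CodeFP.id unE).pair (const _ 2))).pair (unMul.comp (hp.pair ((cntRFP P.prog.rule).comp hY)))) :)
  have hS : CodeFP unE unE (fun n => P.stepBound.eval n * ucnt P.prog.rule (P.activeBound.eval n + n)) :=
    (unMul.comp (hp.pair ((ucntFP P.prog.rule).comp hY)) :)
  exact ((unAdd.comp ((μRBFP.comp ((hM.pair hS).pair ((uBFP (symB P.prog.rule) (arB P.prog.rule)).comp hM))).pair
    ((gdRFP P.prog.rule).comp (hY.pair hM)))).congr fun n => by simp only [budget])

/-- **The status of the budgeted simulation is polynomial time on codes**: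
`(1ⁿ, adj) ↦` the status of `runP P (budget P n) n adj`. [Blass–Gurevich–Shelah 1999, §5.2
Theorem 1] [folklore] -/
theorem runStatusFP (P : CPTCardProgram) :
    CodeFP (pairE unE strE) natE (fun p => (runP P (budget P p.1) p.1 p.2).2.2.2) := by
  have hn : CodeFP (pairE unE strE) unE (fun p => p.1) := (fst _ _ :)
  have hpar : CodeFP (pairE unE strE) runparE (fun p => (budget P p.1, (p.1, (p.2, (P.activeBound.eval p.1,
      P.stepBound.eval p.1))))) :=
    (((budgetFP P).comp hn).pair (hn.pair ((snd _ _).pair (((natPolyFP _).comp hn).pair ((unPolyFP _).comp hn)))) :)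
  have h : CodeFP (pairE unE strE) rsE (fun p => runP P (budget P p.1) p.1 p.2) :=
    ((runFP P.prog.rule).comp hpar).congr fun p => by simp only [runP]
  exact (h.snd'.snd'.snd' :)

end Literature.ModelTheory.FiniteModelTheory.BGS.Sim
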